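import Mathlib.FieldTheory.KummerExtension
import Literature.NumberTheory.GaloisRepresentations.SuperellipticTorsionRep
import Literature.NumberTheory.DiophantineGeometry.FunctionFieldFundamentalEquality
import Literature.NumberTheory.DiophantineGeometry.RatFuncPlaces
import HarnessLib

/-!
# `J(C_f)[1 - ζ]` is the heart of the permutation module on the roots of `f`:
# proof of `superelliptic_lambdaTorsion_iso_heart` (Poonen–Schaefer 1997 / Schaefer 1998 / Zarhin 2018 Thm. 9.1)

This file discharges the named fact `superelliptic_lambdaTorsion_iso_heart` of
`SuperellipticTorsionRep` (`superelliptic_lambdaTorsion_iso_heart_holds`, at the end): for a field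
`K`, a prime `p` with `ζ_p ∈ K`, and `f ∈ K[X]` separable of degree `≥ 3` divisible by `p`, the map
`Ψ : Heart p (f.rootSet K̄) →+ Pic(C_{f,K̄})`, `a ↦ [∑_α ã_α ((α,0) - (α₀,0))]`, is injective,
`Gal(K̄/K)`-equivariant and has image `J[λ]` = the degree-zero classes fixed by the deck group
`y ↦ ζ y` of `C_f : y^p = f(x)`.  We formalise the classical function-field proof (Schaefer,
Math. Ann. 310 (1998) §3, Prop. 3.2–3.4; Poonen–Schaefer, J. reine angew. Math. 488 (1997) §§5–6;
Zarhin arXiv:1706.00110 §§7–9), for an arbitrary algebraically closed `L ⊇ K` in place of `K̄`, in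
four parts:

1. **Ramification** (`SuperellipticFunctionField.genX`, `genY`, `ramificationIdx`, `rootPlace`):
   orders at the places of `L(x)` (`ord_placeXSubC_X_sub_C`, `ord_ratFuncInftyPlace_algebraMap`),
   `v_Q(z) = e(Q|P) v_P(z)`, and total ramification above the roots: above `P_α`, `f(α) = 0`, there
   is exactly one place `T_α = rootPlace α`, with `e = p`, `v(y) = 1`, `v(x - α) = p`, `deg T_α = 1`
   (`eq_rootPlace_of_restrict_eq`, …); the deck group fixes `T_α` and automorphisms of `L/K` act by
   `σ T_α = T_{σ α}` (`smul_rootPlace`).  [Stichtenoth Prop. 3.7.3, Thm. 3.1.11]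
2. **Unramified fibres** (`fibre_spec`, the labelling argument): above a non-root `β` (`u = y`,
   `u^p ≡ f(β)`) and above `∞` (`u = y/x^k`, `u^p ≡ lead f`, `deg f = pk`) every place has a unique
   label `b`, `b^p = c`, with `u ≡ b`; the deck transformation `ζ₀^j` divides labels by `ζ₀^j`, so
   one place has `p` distinct translates, and the fundamental equality `∑ e(Q|P) deg Q = p`
   (`PlaceOver.sum_ramification_mul_degree_eq`) forces `e = 1` everywhere and ONE deck orbit
   (`ramificationIdx_eq_one_of_eval_ne_zero`, `exists_deck_smul_eq_of_eval_ne_zero`,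
   `…_of_restrict_eq_inftyPlace`).  [Stichtenoth Prop. 3.7.3, Thm. 3.7.1]
3. **Divisors** (`fibreDivisor P = ∑_{Q|P} Q`): `(x - α) = p T_α - Fib ∞`,
   `(x - β) = Fib P_β - Fib ∞`, `(y) = ∑_α T_α - k Fib ∞`; hence `p (T_α - T_β) ∼ 0`,
   `∑_α (T_α - T_{α₀}) ∼ 0`, `Fib P ∼ p T_{α₀}`, and a deck-invariant divisor `D` satisfies
   `D ∼ ∑_α D(T_α)(T_α - T_{α₀}) + (deg D) T_{α₀}`, `deg D ≡ ∑_α D(T_α) (mod p)`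
   (`sub_sum_smul_sub_degree_smul_mem_of_invariant`).  [Schaefer §3]
4. **The map and the theorem** (`psi`, built `𝔽_p`-linearly into `Pic[p]` via
   `Finsupp.linearCombination` / `Submodule.liftQ`; `psi_mk : Ψ[a] = [∑ ã_α (T_α - T_{α₀})]`):
   `psi_mem_lambdaTorsion`; `psi_heartRep` (equivariance, from `σ T_α = T_{σα}` and `∑ a_α = 0`);
   `psi_injective` — if `∑ ã_α (T_α - T_{α₀}) = (h)` then `(ζ₀ h) = (h)`, `ζ₀ h = c h`, and expanding in
   the basis `y^i` of `L(C_f)/L(x)` gives `h = r(x) y^j`, so `ã_α ≡ v_{T_α}(h) ≡ j` for all `α`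
   [Schaefer Prop. 3.2]; `exists_psi_eq` — a `ζ₀`-fixed degree-zero class `[D]` has
   `ζ₀ D - D = (h)` with `N(h) ∈ L^× = (L^×)^p`, so by **Hilbert 90** for `⟨ζ₀⟩` acting on `L(C_f)`
   (`hilbert90`, from Dedekind's independence of characters, Mathlib `linearIndependent_monoidHom`)
   `[D] = [D']` with `D'` deck-invariant, and part 3 applies [Schaefer Prop. 3.4].

Everything is proved (no named facts); the `def`s (`genX`, `genY`, `ramificationIdx`, `rootPlace`,
`fibreDivisor`, `picMk`, `genDiv`, `gen`, `liftDiv`, `liftLin`, `psiLin`, `psi`,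
`CyclicCoverDeck.ofRoot`) are genuine.  The hypothesis `(p : K) ≠ 0` of the fact is implied by
`ζ_p ∈ K` and is not used.  Deliberately NOT here: `dim_{𝔽_p} J[p] = 2g`, the structure of `J[p]` as
a `ℤ[ζ]/p`-module, and anything about `q = p^r`, `r > 1` (Zarhin Thm. 9.1 in general).

## References

* B. Poonen, E. F. Schaefer, *Explicit descent for Jacobians of cyclic covers of the projective
  line*, J. reine angew. Math. 488 (1997) 141–188, §§5–6. [PoonenSchaefer1997]
* E. F. Schaefer, *Computing a Selmer group of a Jacobian using functions on the curve*,
  Math. Ann. 310 (1998) 447–471, §3 (Prop. 3.2–3.4). [Schaefer1998]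
* Yu. G. Zarhin, *Endomorphism algebras of abelian varieties with special reference to
  superelliptic Jacobians*, in: Geometry, Algebra, Number Theory, and Their Information Technology
  Applications, Springer PROMS 251 (2018) = arXiv:1706.00110, §§7–9, Thm. 9.1.
  [Zarhin2018SuperellipticJacobians]
* H. Stichtenoth, *Algebraic Function Fields and Codes*, 2nd ed., GTM 254 (2009), Prop. 1.2.1,
  Thm. 1.2.2, Def. 3.1.5, Thm. 3.1.11, Lemma 3.5.2, Thm. 3.7.1, Prop. 3.7.3. [Stichtenoth2009]
-/


/-!
## Part 1. Ramification of the superelliptic function field `L(x)(y)`, `y^p = f(x)`, over `L(x)`: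
# the places above the roots of `f`

First file of the proof of the named fact `superelliptic_lambdaTorsion_iso_heart`
(`SuperellipticTorsionRep`; Zarhin 2018 Thm. 9.1 for `q = p` = Poonen–Schaefer 1997 / Schaefer 1998:
`J(C_f)[1 - ζ] ≅` the heart of `𝔽_p^{R_f}` for the curve `C_f : y^p = f(x)`).  We follow the
classical function-field proof (Schaefer, *Computing a Selmer group of a Jacobian using functions on
the curve*, Math. Ann. 310 (1998), §3, Prop. 3.2–3.4, and Poonen–Schaefer 1997 §5–6), whose first
ingredient is the ramification of the cyclic cover `C_f → ℙ¹` — this file: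

* `SuperellipticFunctionField.genX`, `genY` — the generators `x, y` of
  `L(C_f) = SuperellipticFunctionField K L p f` (`y^p = f(x)`, `genY_pow`); `[L(C_f) : L(x)] = p`
  (`finrank_eq`).
* orders at the places of `L(x)`: `ord_placeXSubC_X_sub_C` (`v_a(x - a) = 1`),
  `ord_placeXSubC_algebraMap_of_eval_ne_zero`, `ord_ratFuncInftyPlace_algebraMap`
  (`v_∞(g) = -deg g`), and over an algebraically closed `L` every place of `L(x)` is `P_∞` or some
  `P_a` (`eq_ratFuncInftyPlace_or_exists_eq_placeXSubC`).
* `SuperellipticFunctionField.ramificationIdx Q = e(Q | Q ∩ L(x))` and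
  `ord_algebraMap_ratFunc : v_Q(z) = e · v_{Q ∩ L(x)}(z)`.
* **Total ramification above the roots** (`f` separable, `p` prime): above the place `P_α` of a
  root `α ∈ L` of `f` there is exactly ONE place `rootPlace α` of `L(C_f)`, with `e = p`,
  `v(y) = 1`, `v(x - α) = p`, of degree one (`eq_rootPlace_of_restrict_eq`,
  `ramificationIdx_rootPlace`, `ord_rootPlace_genY`, `ord_rootPlace_genX_sub`); a place `Q` is
  `rootPlace α` iff `v_Q(x - α) > 0` (`eq_rootPlace_iff_ord_pos`).
* the deck group `μ_p(L)` (`y ↦ ζ y`) fixes every `rootPlace α` (`deck_smul_rootPlace`), and a group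
  of automorphisms of `L/K` permutes them as it permutes the roots
  (`smul_rootPlace : σ • rootPlace α = rootPlace (σ α)`).

The places above the non-roots and above `∞` (unramified, permuted simply transitively by the deck
group) are treated in `SuperellipticFibres`; divisors and the isomorphism itself in
`SuperellipticDivisors`, `SuperellipticTorsionRepProofs`.  Everything here is proved; no named facts,
and the `def`s (`genX`, `genY`, `ramificationIdx`, `rootPlace`) are genuine.

## References

* E. F. Schaefer, *Computing a Selmer group of a Jacobian using functions on the curve*,
  Math. Ann. 310 (1998) 447–471, §3. [Schaefer1998]
* B. Poonen, E. F. Schaefer, *Explicit descent for Jacobians of cyclic covers of the projective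
  line*, J. reine angew. Math. 488 (1997) 141–188, §§5–6. [PoonenSchaefer1997]
* Yu. G. Zarhin, *Endomorphism algebras of abelian varieties with special reference to
  superelliptic Jacobians*, arXiv:1706.00110, Thm. 9.1. [Zarhin2018SuperellipticJacobians]
* H. Stichtenoth, *Algebraic Function Fields and Codes*, 2nd ed., GTM 254 (2009), Prop. 1.2.1,
  Def. 3.1.5, Thm. 3.1.11, Prop. 3.7.3 (Kummer extensions). [Stichtenoth2009]
-/

noncomputable section

open Polynomial
open scoped Classical

namespace Literature.NumberTheory.GaloisRepresentations

open Literature.NumberTheory.DiophantineGeometry Literature.NumberTheory.DiophantineGeometry.AlgFunctionField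
open IsDedekindDomain

universe u v w

/-! ### Orders at the places of the rational function field -/

section RatFuncOrd

variable {L : Type v} [Field L]

/-- The order at `P_a` read off from the `(X - a)`-adic valuation: `n ≤ v_{P_a}(z) ↔ |z|_a ≤ exp(-n)`.
[cite: Stichtenoth2009, Prop. 1.2.1(a)] -/
theorem le_ord_placeXSubC_iff (a : L) {z : RatFunc L} (hz : z ≠ 0) (n : ℤ) :
    n ≤ (placeXSubC a).ord z ↔ (idealXSubC a).valuation (RatFunc L) z ≤ WithZero.exp (-n) := by
  rw [← (placeXSubC a).valuation_le_zpow_iff_le_ord hz n]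
  have h := PlaceOver.valuation_ofPrime_le_iff (K := L) (F := RatFunc L) (idealXSubC a) z (-n)
  rw [neg_neg] at h
  exact h

/-- **`v_{P_a}(x - a) = 1`**: `x - a` is a prime element of `P_a` (Stichtenoth Prop. 1.2.1 (a)).
[cite: Stichtenoth2009, Prop. 1.2.1(a)] -/
theorem ord_placeXSubC_X_sub_C (a : L) :
    (placeXSubC a).ord (RatFunc.X - RatFunc.C a : RatFunc L) = 1 := by
  have hz : (RatFunc.X - RatFunc.C a : RatFunc L) ≠ 0 := by
    rw [← RatFunc.algebraMap_X, ← RatFunc.algebraMap_C, ← map_sub]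
    exact (map_ne_zero_iff _ (IsFractionRing.injective L[X] (RatFunc L))).2 (X_sub_C_ne_zero a)
  refine eq_of_forall_le_iff fun n => ?_
  rw [le_ord_placeXSubC_iff a hz, valuation_idealXSubC_X_sub_C, WithZero.exp_le_exp]
  omega

/-- **`v_{P_a}(g) = 0` for a polynomial `g` with `g(a) ≠ 0`** (`g` is a unit of `O_{P_a}`,
Stichtenoth Prop. 1.2.1 (a)). [cite: Stichtenoth2009, Prop. 1.2.1(a)] -/
theorem ord_placeXSubC_algebraMap_of_eval_ne_zero (a : L) {g : L[X]} (hg : g.eval a ≠ 0) :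
    (placeXSubC a).ord (algebraMap L[X] (RatFunc L) g) = 0 := by
  have hg0 : g ≠ 0 := by rintro rfl; exact hg (eval_zero)
  have hz : algebraMap L[X] (RatFunc L) g ≠ 0 :=
    (map_ne_zero_iff _ (IsFractionRing.injective L[X] (RatFunc L))).2 hg0
  have hval : (idealXSubC a).valuation (RatFunc L) (algebraMap L[X] (RatFunc L) g) = 1 := by
    refine le_antisymm (HeightOneSpectrum.valuation_le_one _ _) ?_
    by_contra h
    rw [not_le, HeightOneSpectrum.valuation_lt_one_iff_mem, mem_idealXSubC_iff] at h
    exact hg h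
  refine eq_of_forall_le_iff fun n => ?_
  rw [le_ord_placeXSubC_iff a hz, hval, ← WithZero.exp_zero, WithZero.exp_le_exp]
  omega

variable (L) in
/-- **`v_∞(g) = -deg g`** for a nonzero polynomial `g` (Stichtenoth Prop. 1.2.1 (c)).
[cite: Stichtenoth2009, Prop. 1.2.1(c)] -/
theorem ord_ratFuncInftyPlace_algebraMap {g : L[X]} (hg : g ≠ 0) :
    (ratFuncInftyPlace L).ord (algebraMap L[X] (RatFunc L) g) = -(g.natDegree : ℤ) := by
  have hz : algebraMap L[X] (RatFunc L) g ≠ 0 :=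
    (map_ne_zero_iff _ (IsFractionRing.injective L[X] (RatFunc L))).2 hg
  refine eq_of_forall_le_iff fun n => ?_
  rw [← (ratFuncInftyPlace L).valuation_le_zpow_iff_le_ord hz n, ← neg_neg n,
    valuation_ratFuncInftyPlace_le_iff, neg_neg, RatFunc.inftyValuation_apply,
    RatFunc.inftyValuation_of_nonzero L hz, RatFunc.intDegree_polynomial, WithZero.exp_le_exp]
  omega

variable (L) in
/-- `v_∞(x) = -1`. [cite: Stichtenoth2009, Prop. 1.2.1(c)] -/
theorem ord_ratFuncInftyPlace_ratFuncX : (ratFuncInftyPlace L).ord (RatFunc.X : RatFunc L) = -1 := by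
  rw [← RatFunc.algebraMap_X, ord_ratFuncInftyPlace_algebraMap L X_ne_zero, natDegree_X]
  rfl

/-- `v_∞(x - a) = -1`. [cite: Stichtenoth2009, Prop. 1.2.1(c)] -/
theorem ord_ratFuncInftyPlace_X_sub_C (a : L) :
    (ratFuncInftyPlace L).ord (RatFunc.X - RatFunc.C a : RatFunc L) = -1 := by
  rw [← RatFunc.algebraMap_X, ← RatFunc.algebraMap_C, ← map_sub,
    ord_ratFuncInftyPlace_algebraMap L (X_sub_C_ne_zero a), natDegree_X_sub_C]
  rfl

/-- `v_{P_b}(x - a) = 0` for `b ≠ a`. [cite: Stichtenoth2009, Prop. 1.2.1(a)] -/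
theorem ord_placeXSubC_X_sub_C_of_ne {a b : L} (h : b ≠ a) :
    (placeXSubC b).ord (RatFunc.X - RatFunc.C a : RatFunc L) = 0 := by
  rw [← RatFunc.algebraMap_X, ← RatFunc.algebraMap_C, ← map_sub]
  refine ord_placeXSubC_algebraMap_of_eval_ne_zero b ?_
  rw [eval_sub, eval_X, eval_C]
  exact sub_ne_zero.2 h

/-- Over an **algebraically closed** field every nonzero prime of `L[X]` is some `(X - a)`.
[folklore] -/
theorem exists_eq_idealXSubC [IsAlgClosed L] (q : HeightOneSpectrum L[X]) : ∃ a : L, q = idealXSubC a := by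
  obtain ⟨g, hg⟩ := (IsPrincipalIdealRing.principal q.asIdeal).principal
  have hg0 : g ≠ 0 := by
    rintro rfl
    exact q.ne_bot (by rw [hg, Submodule.span_singleton_eq_bot.2 rfl])
  have hgspan : q.asIdeal = Ideal.span {g} := hg
  have hprime : Prime g := (Ideal.span_singleton_prime hg0).1 (hgspan ▸ q.isPrime)
  have hdeg : g.degree = 1 := IsAlgClosed.degree_eq_one_of_irreducible L hprime.irreducible
  obtain ⟨a, ha⟩ := exists_root_of_degree_eq_one hdeg
  refine ⟨a, HeightOneSpectrum.ext ?_⟩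
  have hle : q.asIdeal ≤ (idealXSubC a).asIdeal := by
    rw [hgspan, Ideal.span_le, Set.singleton_subset_iff, SetLike.mem_coe, mem_idealXSubC_iff]
    exact ha
  have hmax : q.asIdeal.IsMaximal := q.isPrime.isMaximal q.ne_bot
  exact hmax.eq_of_le (idealXSubC a).isPrime.ne_top hle

variable (L) in
/-- Over an algebraically closed `L`, every place of `L(x)/L` is `P_∞` or some `P_a`, `a ∈ L`
(Stichtenoth Thm. 1.2.2 with Cor. 1.2.3). [cite: Stichtenoth2009, Thm. 1.2.2] -/
theorem eq_ratFuncInftyPlace_or_exists_eq_placeXSubC [IsAlgClosed L] (P : PlaceOver L (RatFunc L)) :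
    P = ratFuncInftyPlace L ∨ ∃ a : L, P = placeXSubC a := by
  rcases eq_ratFuncInftyPlace_or_exists_eq_ofPrime P with h | ⟨q, hq⟩
  · exact Or.inl h
  · obtain ⟨a, rfl⟩ := exists_eq_idealXSubC q
    exact Or.inr ⟨a, hq⟩

/-- `P_a ≠ P_∞`. [folklore] -/
theorem placeXSubC_ne_ratFuncInftyPlace (a : L) : placeXSubC a ≠ ratFuncInftyPlace L :=
  ofPrime_ne_ratFuncInftyPlace (idealXSubC a)

end RatFuncOrd

/-! ### The generators `x, y` of `L(C_f)` and the degree `[L(C_f) : L(x)] = p` -/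

namespace SuperellipticFunctionField

variable (K : Type u) [Field K] (L : Type v) [Field L] [Algebra K L] (p : ℕ) (f : K[X])
variable [Fact (Irreducible (superellipticPoly K L p f))]

/-- The function `x ∈ L(C_f)` (image of `X ∈ L[X]`). [cite: Zarhin2018SuperellipticJacobians, §8] -/
def genX : SuperellipticFunctionField K L p f :=
  algebraMap L[X] (SuperellipticFunctionField K L p f) X

/-- The function `y ∈ L(C_f)` (the class of `Y` in `L(x)[Y]/(Y^p - f(x))`).
[cite: Zarhin2018SuperellipticJacobians, §8] -/
def genY : SuperellipticFunctionField K L p f :=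
  AdjoinRoot.root (superellipticPoly K L p f)

/-- `x` is the image of `X ∈ L(x)`. [folklore] -/
theorem genX_eq_algebraMap_ratFunc :
    genX K L p f = algebraMap (RatFunc L) (SuperellipticFunctionField K L p f) RatFunc.X :=
  (algebraMap_ratFunc_X (K := L) (F := SuperellipticFunctionField K L p f)).symm

/-- `g(x) ∈ L(C_f)` is the image of `g ∈ L[X]`. [folklore] -/
theorem aeval_genX (g : L[X]) :
    aeval (genX K L p f) g = algebraMap L[X] (SuperellipticFunctionField K L p f) g := by
  rw [genX, aeval_algebraMap_apply, aeval_X_left_apply]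

/-- `L[X] → L(C_f)` is injective. [folklore] -/
theorem algebraMap_polynomial_injective :
    Function.Injective (algebraMap L[X] (SuperellipticFunctionField K L p f)) := by
  rw [IsScalarTower.algebraMap_eq L[X] (RatFunc L) (SuperellipticFunctionField K L p f)]
  exact (algebraMap (RatFunc L) _).injective.comp (IsFractionRing.injective L[X] (RatFunc L))

/-- **`y^p = f(x)`** in `L(C_f)`. [cite: Zarhin2018SuperellipticJacobians, §8] -/
theorem genY_pow :
    genY K L p f ^ p = algebraMap L[X] (SuperellipticFunctionField K L p f) (f.map (algebraMap K L)) := by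
  have h := AdjoinRoot.aeval_eq (f := superellipticPoly K L p f) (superellipticPoly K L p f)
  rw [AdjoinRoot.mk_self, aeval_superellipticPoly] at h
  rw [genY, IsScalarTower.algebraMap_apply L[X] (RatFunc L) (SuperellipticFunctionField K L p f)]
  exact (sub_eq_zero.1 h)

/-- `y^p = f(x)` with `f(x) = aeval x f`. [folklore] -/
theorem genY_pow_eq_aeval : genY K L p f ^ p = aeval (genX K L p f) (f.map (algebraMap K L)) := by
  rw [aeval_genX, genY_pow]

/-- `x` is transcendental over `L`. [folklore] -/
theorem transcendental_genX : Transcendental L (genX K L p f) :=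
  transcendental_algebraMap_X L (SuperellipticFunctionField K L p f)

/-- `x ≠ a` for every constant `a`. [folklore] -/
theorem genX_sub_algebraMap_ne_zero (a : L) :
    genX K L p f - algebraMap L (SuperellipticFunctionField K L p f) a ≠ 0 := fun h =>
  transcendental_genX K L p f (by rw [sub_eq_zero.1 h]; exact isAlgebraic_algebraMap a)

/-- `x - a` is the image of `X - a ∈ L(x)`. [folklore] -/
theorem genX_sub_algebraMap (a : L) :
    genX K L p f - algebraMap L (SuperellipticFunctionField K L p f) a =
      algebraMap (RatFunc L) (SuperellipticFunctionField K L p f) (RatFunc.X - RatFunc.C a) := by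
  rw [map_sub, ← genX_eq_algebraMap_ratFunc, ← RatFunc.algebraMap_eq_C, ← IsScalarTower.algebraMap_apply]

/-- **`[L(C_f) : L(x)] = p`** (the power basis `1, y, …, y^{p-1}`). [folklore] -/
theorem finrank_eq : Module.finrank (RatFunc L) (SuperellipticFunctionField K L p f) = p := by
  rw [(AdjoinRoot.powerBasis (Fact.out : Irreducible (superellipticPoly K L p f)).ne_zero).finrank,
    AdjoinRoot.powerBasis_dim, natDegree_superellipticPoly]

variable {K L p f}

/-- `y ≠ 0` when `f ≠ 0` and `p ≠ 0`. [folklore] -/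
theorem genY_ne_zero (hp : p ≠ 0) (hf : f ≠ 0) : genY K L p f ≠ 0 := by
  intro h
  have h1 := genY_pow K L p f
  rw [h, zero_pow hp, eq_comm, map_eq_zero_iff _ (algebraMap_polynomial_injective K L p f),
    Polynomial.map_eq_zero] at h1
  exact hf h1

/-! ### The ramification index of a place of `L(C_f)` over `L(x)` -/

variable (K L p f) in
/-- The ramification index `e(Q | P)`, `P = Q ∩ L(x)`, of a place `Q` of `L(C_f)/L`: the order at
`Q` of a prime element of `P` (Stichtenoth Def. 3.1.5). [cite: Stichtenoth2009, Def. 3.1.5] -/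
def ramificationIdx (Q : PlaceOver L (SuperellipticFunctionField K L p f)) : ℤ :=
  Q.ord (algebraMap (RatFunc L) (SuperellipticFunctionField K L p f)
    ((Q.restrict (K := L) (F := RatFunc L)).uniformizer : RatFunc L))

/-- **`v_Q(z) = e(Q|P) · v_P(z)`** for `z ∈ L(x)` (Stichtenoth Prop. 3.1.4).
[cite: Stichtenoth2009, Prop. 3.1.4] -/
theorem ord_algebraMap_ratFunc (Q : PlaceOver L (SuperellipticFunctionField K L p f)) (z : RatFunc L) :
    Q.ord (algebraMap (RatFunc L) (SuperellipticFunctionField K L p f) z) =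
      ramificationIdx K L p f Q * (Q.restrict (K := L) (F := RatFunc L)).ord z :=
  Q.ord_algebraMap_eq_mul (K := L) z

/-- `1 ≤ e(Q|P)`. [cite: Stichtenoth2009, Def. 3.1.5] -/
theorem one_le_ramificationIdx (Q : PlaceOver L (SuperellipticFunctionField K L p f)) :
    1 ≤ ramificationIdx K L p f Q :=
  Q.one_le_ord_algebraMap_uniformizer (K := L) (F := RatFunc L)

/-- `e(Q|P) ≤ [L(C_f) : L(x)] = p`. [cite: Stichtenoth2009, Thm. 3.1.11] -/
theorem ramificationIdx_le (Q : PlaceOver L (SuperellipticFunctionField K L p f)) :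
    ramificationIdx K L p f Q ≤ p := by
  have h := PlaceOver.ord_algebraMap_uniformizer_le_finrank (K := L) (F := RatFunc L) (P' := Q) rfl
  rwa [finrank_eq] at h

/-- `v_Q(x - a) = e(Q|P) · v_P(x - a)`. [folklore] -/
theorem ord_genX_sub_algebraMap (Q : PlaceOver L (SuperellipticFunctionField K L p f)) (a : L) :
    Q.ord (genX K L p f - algebraMap L _ a) =
      ramificationIdx K L p f Q * (Q.restrict (K := L) (F := RatFunc L)).ord (RatFunc.X - RatFunc.C a) := by
  rw [genX_sub_algebraMap, ord_algebraMap_ratFunc]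

/-- **A place `Q` with `v_Q(x - a) > 0` lies above `P_a`** (Stichtenoth Thm. 1.2.2: `Q ∩ L(x)` is a
place of `L(x)` containing `x`, hence some `P_{q(x)}`, and `q = x - a` since `x - a` is not a unit;
the argument of `restrict_eq_placeXSubC_of_valuation_lt_one` of the plane-curve files, repeated here to
keep the imports light). [cite: Stichtenoth2009, Thm. 1.2.2] -/
theorem restrict_eq_placeXSubC_of_ord_pos {Q : PlaceOver L (SuperellipticFunctionField K L p f)} {a : L}
    (h : 0 < Q.ord (genX K L p f - algebraMap L _ a)) :
    Q.restrict (K := L) (F := RatFunc L) = placeXSubC a := by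
  set x := genX K L p f with hx
  have hw0 := genX_sub_algebraMap_ne_zero (K := K) (L := L) (p := p) (f := f) a
  have hlt : Q.valuation (x - algebraMap L _ a) < 1 := (Q.valuation_lt_one_iff_ord_pos hw0).2 h
  have hxaQ : x - algebraMap L _ a ∈ Q.toValuationSubring :=
    (Q.toValuationSubring.valuation_le_one_iff _).1 hlt.le
  have hxQ : x ∈ Q.toValuationSubring := by
    have : x = (x - algebraMap L _ a) + algebraMap L _ a := by ring
    rw [this]; exact add_mem hxaQ (Q.algebraMap_mem a)
  set P := Q.restrict (K := L) (F := RatFunc L) with hP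
  rcases eq_ratFuncInftyPlace_or_exists_eq_ofPrime P with hinf | ⟨q, hq⟩
  · exfalso
    have h1 : (RatFunc.X : RatFunc L) ∈ P.toValuationSubring := by
      rw [hP, PlaceOver.mem_restrict_iff, ← genX_eq_algebraMap_ratFunc]; exact hxQ
    rw [hinf, mem_ratFuncInftyPlace_iff, RatFunc.inftyValuation.X, ← WithZero.exp_zero,
      WithZero.exp_le_exp] at h1
    exact absurd h1 (by norm_num)
  · have hmem : (X - C a : L[X]) ∈ q.asIdeal := by
      rw [← HeightOneSpectrum.valuation_lt_one_iff_mem (K := RatFunc L)]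
      by_contra hge
      rw [not_lt] at hge
      have heq : q.valuation (RatFunc L) (algebraMap L[X] (RatFunc L) (X - C a)) = 1 :=
        le_antisymm (HeightOneSpectrum.valuation_le_one q _) hge
      have hinvQ : (algebraMap L[X] (RatFunc L) (X - C a))⁻¹ ∈ P.toValuationSubring := by
        rw [hq, PlaceOver.mem_ofPrime_iff, map_inv₀, heq, inv_one]
      rw [hP, PlaceOver.mem_restrict_iff, map_inv₀, map_sub, RatFunc.algebraMap_X,
        RatFunc.algebraMap_C, ← genX_sub_algebraMap] at hinvQ
      have h1 : Q.valuation (x - algebraMap L _ a)⁻¹ ≤ 1 :=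
        (Q.toValuationSubring.valuation_le_one_iff _).2 hinvQ
      have h2 : 1 < Q.valuation (x - algebraMap L _ a)⁻¹ := by
        rw [Valuation.one_lt_val_iff _ (inv_ne_zero hw0), inv_inv]; exact hlt
      exact not_lt.2 h1 h2
    have hqeq : q = idealXSubC a := by
      have hmax : (idealXSubC a).asIdeal.IsMaximal := by
        rw [idealXSubC_asIdeal]
        exact PrincipalIdealRing.isMaximal_of_irreducible (irreducible_X_sub_C a)
      have hle : (idealXSubC a).asIdeal ≤ q.asIdeal := by
        rw [idealXSubC_asIdeal, Ideal.span_le, Set.singleton_subset_iff]; exact hmem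
      exact HeightOneSpectrum.ext (hmax.eq_of_le q.isPrime.ne_top hle).symm
    rw [hq, hqeq]; rfl

/-- **A place above `P_a` has `v_Q(x - a) > 0`** (`1/(x - a) ∉ O_{P_a}`). [folklore] -/
theorem ord_pos_of_restrict_eq_placeXSubC {Q : PlaceOver L (SuperellipticFunctionField K L p f)} {a : L}
    (h : Q.restrict (K := L) (F := RatFunc L) = placeXSubC a) :
    0 < Q.ord (genX K L p f - algebraMap L _ a) := by
  rw [ord_genX_sub_algebraMap, h, ord_placeXSubC_X_sub_C, mul_one]
  exact lt_of_lt_of_le zero_lt_one (one_le_ramificationIdx Q)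

/-- **A place `Q` lies above `P_a` iff `v_Q(x - a) > 0`.** [cite: Stichtenoth2009, Thm. 1.2.2] -/
theorem restrict_eq_placeXSubC_iff (Q : PlaceOver L (SuperellipticFunctionField K L p f)) (a : L) :
    Q.restrict (K := L) (F := RatFunc L) = placeXSubC a ↔ 0 < Q.ord (genX K L p f - algebraMap L _ a) :=
  ⟨ord_pos_of_restrict_eq_placeXSubC, restrict_eq_placeXSubC_of_ord_pos⟩

/-- Above `P_∞`: `v_Q(x) = -e(Q|P_∞) < 0`. [folklore] -/
theorem ord_genX_of_restrict_eq_inftyPlace {Q : PlaceOver L (SuperellipticFunctionField K L p f)}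
    (hQ : Q.restrict (K := L) (F := RatFunc L) = ratFuncInftyPlace L) :
    Q.ord (genX K L p f) = -ramificationIdx K L p f Q := by
  rw [genX_eq_algebraMap_ratFunc, ord_algebraMap_ratFunc, hQ, ord_ratFuncInftyPlace_ratFuncX, mul_neg, mul_one]

/-- Above a finite place: `x ∈ O_Q`. [folklore] -/
theorem genX_mem_of_restrict_eq_placeXSubC {Q : PlaceOver L (SuperellipticFunctionField K L p f)} {b : L}
    (hQ : Q.restrict (K := L) (F := RatFunc L) = placeXSubC b) : genX K L p f ∈ Q.toValuationSubring := by
  have h : (RatFunc.X : RatFunc L) ∈ (placeXSubC b).toValuationSubring := by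
    have h1 := X_sub_C_mem_placeXSubC b
    have h2 : (RatFunc.C b : RatFunc L) ∈ (placeXSubC b).toValuationSubring := by
      rw [← RatFunc.algebraMap_eq_C]; exact (placeXSubC b).algebraMap_mem b
    simpa using add_mem h1 h2
  rw [← hQ, PlaceOver.mem_restrict_iff] at h
  rwa [genX_eq_algebraMap_ratFunc]

/-- Above a finite place: `g(x) ∈ O_Q` for every polynomial `g`. [folklore] -/
theorem aeval_genX_mem_of_restrict_eq_placeXSubC {Q : PlaceOver L (SuperellipticFunctionField K L p f)}
    {b : L} (hQ : Q.restrict (K := L) (F := RatFunc L) = placeXSubC b) (g : L[X]) :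
    aeval (genX K L p f) g ∈ Q.toValuationSubring := by
  have hx := genX_mem_of_restrict_eq_placeXSubC hQ
  refine Polynomial.induction_on g (fun c => ?_) (fun g₁ g₂ h₁ h₂ => ?_) (fun n c h => ?_)
  · rw [aeval_C]; exact Q.algebraMap_mem c
  · rw [map_add]; exact add_mem h₁ h₂
  · rw [pow_succ, ← mul_assoc, map_mul, aeval_X]
    exact mul_mem h hx

/-! ### The places `T_α` above the `P_α`; deck and Galois actions on places -/

/-- `e(Q|P)` computed with any name `P` of the place below. [folklore] -/
theorem ramificationIdx_eq_of_restrict_eq {Q : PlaceOver L (SuperellipticFunctionField K L p f)}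
    {P : PlaceOver L (RatFunc L)} (h : Q.restrict (K := L) (F := RatFunc L) = P) :
    ramificationIdx K L p f Q =
      Q.ord (algebraMap (RatFunc L) (SuperellipticFunctionField K L p f) (P.uniformizer : RatFunc L)) := by
  subst h; rfl

/-- **`p · v_Q(y) = e(Q|P) · v_P(f)`** (from `y^p = f(x)`). [cite: Stichtenoth2009, Prop. 3.7.3 (proof)] -/
theorem natCast_mul_ord_genY (hp : p ≠ 0) (hf : f ≠ 0)
    (Q : PlaceOver L (SuperellipticFunctionField K L p f)) :
    (p : ℤ) * Q.ord (genY K L p f) =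
      ramificationIdx K L p f Q *
        (Q.restrict (K := L) (F := RatFunc L)).ord (algebraMap L[X] (RatFunc L) (f.map (algebraMap K L))) := by
  rw [← Q.ord_pow (genY_ne_zero hp hf) p, genY_pow,
    IsScalarTower.algebraMap_apply L[X] (RatFunc L) (SuperellipticFunctionField K L p f), ord_algebraMap_ratFunc]

/-- **`v_{P_α}(f) = 1` at a simple root `α`** of `f` (`f` separable). [folklore] -/
theorem ord_placeXSubC_map_of_isRoot (hsep : f.Separable) {α : L} (hα : (f.map (algebraMap K L)).IsRoot α) :
    (placeXSubC α).ord (algebraMap L[X] (RatFunc L) (f.map (algebraMap K L))) = 1 := by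
  set g := f.map (algebraMap K L) with hg
  have hg0 : g ≠ 0 := (Polynomial.map_ne_zero_iff (algebraMap K L).injective).2 hsep.ne_zero
  obtain ⟨q, hq, hdvd⟩ := exists_eq_pow_rootMultiplicity_mul_and_not_dvd g hg0 α
  have hm : g.rootMultiplicity α = 1 :=
    le_antisymm (rootMultiplicity_le_one_of_separable hsep.map α) ((rootMultiplicity_pos hg0).2 hα)
  rw [hm, pow_one] at hq
  have hqα : q.eval α ≠ 0 := fun h => hdvd (dvd_iff_isRoot.2 h)
  have hq0 : q ≠ 0 := by rintro rfl; exact hqα eval_zero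
  have hXa : algebraMap L[X] (RatFunc L) (X - C α) ≠ 0 :=
    (map_ne_zero_iff _ (IsFractionRing.injective L[X] (RatFunc L))).2 (X_sub_C_ne_zero α)
  have hq' : algebraMap L[X] (RatFunc L) q ≠ 0 :=
    (map_ne_zero_iff _ (IsFractionRing.injective L[X] (RatFunc L))).2 hq0
  rw [hq, map_mul, (placeXSubC α).ord_mul_eq hXa hq', ord_placeXSubC_algebraMap_of_eval_ne_zero α hqα,
    add_zero, map_sub, RatFunc.algebraMap_X, RatFunc.algebraMap_C, ord_placeXSubC_X_sub_C]

variable (K L p f) in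
/-- **The place `T_α` of `L(C_f)` above `P_α`** (for a root `α` of `f`: the unique, totally ramified
place above `x = α`, the point `(α, 0)` of the curve; for other `α` just some place above `P_α`).
[cite: Schaefer1998, §3] -/
def rootPlace (α : L) : PlaceOver L (SuperellipticFunctionField K L p f) :=
  Classical.choose (PlaceOver.exists_restrict_eq' (K := L) (F := RatFunc L)
    (F' := SuperellipticFunctionField K L p f) (placeXSubC α))

/-- `T_α` lies above `P_α`. [folklore] -/
theorem restrict_rootPlace (α : L) :
    (rootPlace K L p f α).restrict (K := L) (F := RatFunc L) = placeXSubC α :=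
  Classical.choose_spec (PlaceOver.exists_restrict_eq' (K := L) (F := RatFunc L)
    (F' := SuperellipticFunctionField K L p f) (placeXSubC α))

/-- `α ↦ T_α` is injective. [folklore] -/
theorem rootPlace_injective : Function.Injective (rootPlace K L p f) := fun α β h => by
  have h1 := restrict_rootPlace (K := K) (L := L) (p := p) (f := f) α
  rw [h, restrict_rootPlace] at h1
  exact (placeXSubC_injective h1).symm

/-- `v_Q(x - b) = 0` for a place `Q` above `P_a`, `a ≠ b`. [folklore] -/
theorem ord_genX_sub_eq_zero_of_restrict_eq {Q : PlaceOver L (SuperellipticFunctionField K L p f)} {a b : L}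
    (hQ : Q.restrict (K := L) (F := RatFunc L) = placeXSubC a) (hab : a ≠ b) :
    Q.ord (genX K L p f - algebraMap L _ b) = 0 := by
  rw [ord_genX_sub_algebraMap, hQ, ord_placeXSubC_X_sub_C_of_ne hab, mul_zero]

/-- The deck transformations fix `L(x)` pointwise. [folklore] -/
theorem deck_smul_algebraMap_ratFunc (ζ : CyclicCoverDeck L p) (z : RatFunc L) :
    ζ • algebraMap (RatFunc L) (SuperellipticFunctionField K L p f) z = algebraMap _ _ z :=
  deck_smul_of K L p f ζ z

/-- **Deck transformations map places above `P` to places above `P`.** [cite: Stichtenoth2009, Lemma 3.5.2] -/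
theorem restrict_deck_smul (ζ : CyclicCoverDeck L p) (Q : PlaceOver L (SuperellipticFunctionField K L p f)) :
    (ζ • Q).restrict (K := L) (F := RatFunc L) = Q.restrict (K := L) (F := RatFunc L) := by
  apply PlaceOver.ext; ext z
  rw [PlaceOver.mem_restrict_iff, PlaceOver.mem_restrict_iff, toValuationSubring_smul,
    ValuationSubring.mem_pointwise_smul_iff_inv_smul_mem, deck_smul_algebraMap_ratFunc]

section Galois

variable {G : Type w} [Group G] [MulSemiringAction G L] [SMulCommClass G K L]

/-- The Galois action fixes `x`. [folklore] -/
theorem smul_genX (σ : G) : σ • genX K L p f = genX K L p f := by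
  rw [genX_eq_algebraMap_ratFunc, AdjoinRoot.algebraMap_eq, smul_superelliptic_of, smul_ratFunc_X]

omit [Fact (Irreducible (superellipticPoly K L p f))] in
/-- Automorphisms of `L/K` permute the roots of `f ∈ K[X]`. [folklore] -/
theorem isRoot_smul (σ : G) {α : L} (hα : (f.map (algebraMap K L)).IsRoot α) :
    (f.map (algebraMap K L)).IsRoot (σ • α) := by
  rw [IsRoot.def, ← smul_map_algebraMap K L f σ, Polynomial.smul_eval_smul, hα.eq_zero, smul_zero]

end Galois

/-! ### Total ramification above the roots of `f` -/

variable [hp : Fact p.Prime]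

/-- **Above a root `α` of `f` the extension is totally ramified: `e(Q|P_α) = p` and `v_Q(y) = 1`**
(`p v_Q(y) = e · v_{P_α}(f) = e` with `1 ≤ e ≤ p`; Stichtenoth Prop. 3.7.3 (b)).
[cite: Stichtenoth2009, Prop. 3.7.3] -/
theorem ramificationIdx_eq_of_isRoot (hsep : f.Separable) {α : L} (hα : (f.map (algebraMap K L)).IsRoot α)
    {Q : PlaceOver L (SuperellipticFunctionField K L p f)}
    (hQ : Q.restrict (K := L) (F := RatFunc L) = placeXSubC α) :
    ramificationIdx K L p f Q = p ∧ Q.ord (genY K L p f) = 1 := by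
  have h := natCast_mul_ord_genY hp.out.ne_zero hsep.ne_zero Q
  rw [hQ, ord_placeXSubC_map_of_isRoot hsep hα, mul_one] at h
  have h1 := one_le_ramificationIdx Q
  have h2 := ramificationIdx_le Q
  have hp1 : (1 : ℤ) ≤ p := by exact_mod_cast hp.out.one_lt.le
  set e := ramificationIdx K L p f Q with he
  set t := Q.ord (genY K L p f) with ht
  have ht1 : 1 ≤ t := by
    by_contra hlt
    have : (p : ℤ) * t ≤ 0 := mul_nonpos_of_nonneg_of_nonpos (by omega) (by omega)
    omega
  have hpt : (p : ℤ) * t = p := le_antisymm (h ▸ h2) (by nlinarith)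
  refine ⟨by rw [← h, hpt], ?_⟩
  have hp0 : (p : ℤ) ≠ 0 := by exact_mod_cast hp.out.ne_zero
  exact mul_left_cancel₀ hp0 (hpt.trans (mul_one (p : ℤ)).symm)

/-- `e(T_α | P_α) = p` for a root `α`. [cite: Stichtenoth2009, Prop. 3.7.3] -/
theorem ramificationIdx_rootPlace (hsep : f.Separable) {α : L} (hα : (f.map (algebraMap K L)).IsRoot α) :
    ramificationIdx K L p f (rootPlace K L p f α) = p :=
  (ramificationIdx_eq_of_isRoot hsep hα (restrict_rootPlace α)).1

/-- `v_{T_α}(y) = 1` for a root `α`. [cite: Schaefer1998, §3] -/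
theorem ord_rootPlace_genY (hsep : f.Separable) {α : L} (hα : (f.map (algebraMap K L)).IsRoot α) :
    (rootPlace K L p f α).ord (genY K L p f) = 1 :=
  (ramificationIdx_eq_of_isRoot hsep hα (restrict_rootPlace α)).2

/-- `e(T_α | P_α) = [L(C_f) : L(x)]`, in the form consumed by the fundamental equality. [folklore] -/
theorem ord_rootPlace_uniformizer_eq_finrank (hsep : f.Separable) {α : L}
    (hα : (f.map (algebraMap K L)).IsRoot α) :
    (rootPlace K L p f α).ord (algebraMap (RatFunc L) (SuperellipticFunctionField K L p f)
        ((placeXSubC α).uniformizer : RatFunc L)) =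
      Module.finrank (RatFunc L) (SuperellipticFunctionField K L p f) := by
  rw [← ramificationIdx_eq_of_restrict_eq (restrict_rootPlace α), ramificationIdx_rootPlace hsep hα,
    finrank_eq]

/-- **`T_α` is the only place above `P_α`** for a root `α` (total ramification,
Stichtenoth Thm. 3.1.11). [cite: Stichtenoth2009, Thm. 3.1.11] -/
theorem eq_rootPlace_of_restrict_eq (hsep : f.Separable) {α : L} (hα : (f.map (algebraMap K L)).IsRoot α)
    {Q : PlaceOver L (SuperellipticFunctionField K L p f)}
    (hQ : Q.restrict (K := L) (F := RatFunc L) = placeXSubC α) : Q = rootPlace K L p f α :=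
  (PlaceOver.eq_of_ord_algebraMap_uniformizer_eq_finrank (K := L) (F := RatFunc L)
    (restrict_rootPlace α) (ord_rootPlace_uniformizer_eq_finrank hsep hα)).1 Q hQ

/-- `deg T_α = 1` for a root `α`. [cite: Stichtenoth2009, Thm. 3.1.11] -/
theorem degree_rootPlace (hsep : f.Separable) {α : L} (hα : (f.map (algebraMap K L)).IsRoot α) :
    (rootPlace K L p f α).degree = 1 := by
  rw [(PlaceOver.eq_of_ord_algebraMap_uniformizer_eq_finrank (K := L) (F := RatFunc L)
    (restrict_rootPlace α) (ord_rootPlace_uniformizer_eq_finrank hsep hα)).2]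
  exact isRational_placeXSubC α

/-- **`Q = T_α ↔ v_Q(x - α) > 0`** for a root `α`. [cite: Schaefer1998, §3] -/
theorem eq_rootPlace_iff_ord_pos (hsep : f.Separable) {α : L} (hα : (f.map (algebraMap K L)).IsRoot α)
    (Q : PlaceOver L (SuperellipticFunctionField K L p f)) :
    Q = rootPlace K L p f α ↔ 0 < Q.ord (genX K L p f - algebraMap L _ α) := by
  rw [← restrict_eq_placeXSubC_iff]
  exact ⟨fun h => h ▸ restrict_rootPlace α, eq_rootPlace_of_restrict_eq hsep hα⟩

/-- **`v_{T_α}(x - α) = p`** for a root `α`. [cite: Schaefer1998, §3] -/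
theorem ord_rootPlace_genX_sub (hsep : f.Separable) {α : L} (hα : (f.map (algebraMap K L)).IsRoot α) :
    (rootPlace K L p f α).ord (genX K L p f - algebraMap L _ α) = p := by
  rw [ord_genX_sub_algebraMap, restrict_rootPlace, ord_placeXSubC_X_sub_C, mul_one,
    ramificationIdx_rootPlace hsep hα]

/-- **The deck group fixes `T_α`.** [cite: Schaefer1998, §3] -/
theorem deck_smul_rootPlace (hsep : f.Separable) {α : L} (hα : (f.map (algebraMap K L)).IsRoot α)
    (ζ : CyclicCoverDeck L p) : ζ • rootPlace K L p f α = rootPlace K L p f α :=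
  eq_rootPlace_of_restrict_eq hsep hα (by rw [restrict_deck_smul, restrict_rootPlace])

section Galois

variable {G : Type w} [Group G] [MulSemiringAction G L] [SMulCommClass G K L]

/-- **`σ T_α = T_{σ α}`**: the Galois action permutes the ramification places as it permutes the
roots (`v_{σ T_α}(x - σ α) = v_{T_α}(x - α) > 0`). [cite: Zarhin2018SuperellipticJacobians, Thm. 9.1 (proof)] -/
theorem smul_rootPlace (hsep : f.Separable) (σ : G) {α : L} (hα : (f.map (algebraMap K L)).IsRoot α) :
    σ • rootPlace K L p f α = rootPlace K L p f (σ • α) := by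
  refine (eq_rootPlace_iff_ord_pos hsep (isRoot_smul σ hα) _).2 ?_
  have h : genX K L p f - algebraMap L _ (σ • α) = σ • (genX K L p f - algebraMap L _ α) := by
    rw [smul_sub, smul_genX, smul_algebraMap_superelliptic]
  rw [h, PlaceOver.ord_smul_smul]
  exact (eq_rootPlace_iff_ord_pos hsep hα _).1 rfl

end Galois

end SuperellipticFunctionField

end Literature.NumberTheory.GaloisRepresentations

/-!
## Part 2. The unramified fibres of the superelliptic cover `y^p = f(x)`: above the non-roots of `f` and
# above `∞` the deck group `μ_p` acts simply transitively

Second file of the proof of `superelliptic_lambdaTorsion_iso_heart` (see `SuperellipticRamification`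
for the setting: `L(C_f) = SuperellipticFunctionField K L p f = L(x)[y]/(y^p - f(x))`, `p` prime,
places `PlaceOver L L(C_f)`, `ramificationIdx Q = e(Q | Q ∩ L(x))`, deck group
`CyclicCoverDeck L p = μ_p(L)` acting by `y ↦ ζ y`).

Let `P` be a rational place of `L(x)` and suppose there are `u ∈ L(C_f)` and `c ∈ L^×` with
`u ∈ O_Q`, `u^p ≡ c (mod Q)` for every place `Q` above `P`, and `ζ u = ζ · u` for the deck
transformations (for `P = P_β`, `f(β) ≠ 0`: `u = y`, `c = f(β)`; for `P = P_∞`, `deg f = pk`: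
`u = y/x^k`, `c = lead f`).  If `L` contains a primitive `p`-th root of unity `ζ₀` and a `p`-th root
`b₀` of `c`, then (`SuperellipticFunctionField.fibre_spec`, the **labelling argument**):

* every `Q` above `P` has a unique *label* `b ∈ {ζ₀^i b₀}` with `u ≡ b (mod Q)`
  (`u^p - c = ∏ (u - ζ₀^i b₀)`, Mathlib `X_pow_sub_C_eq_prod`), and the deck transformation with
  `ζ = ζ₀^j` divides labels by `ζ₀^j`; so the `p` translates of one place above `P` are pairwise
  distinct places above `P`;
* the fundamental equality `∑_{Q | P} e(Q|P) deg Q = [L(C_f) : L(x)] deg P = p`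
  (`PlaceOver.sum_ramification_mul_degree_eq`) then forces: exactly `p` places above `P`, all with
  `e(Q|P) = 1` (and `deg Q = 1`), and they form ONE orbit of the deck group.

Consequences (`[IsAlgClosed L]`, `ζ₀ ∈ L`): `ramificationIdx_eq_one_of_eval_ne_zero`,
`exists_deck_smul_eq_of_eval_ne_zero` (fibres over `P_β`, `f(β) ≠ 0`) and
`ramificationIdx_eq_one_of_restrict_eq_inftyPlace`, `exists_deck_smul_eq_of_restrict_eq_inftyPlace`
(fibre over `∞`, `p ∣ deg f`).  This is the content of Stichtenoth Prop. 3.7.3 (Kummer extensions: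
`e(Q|P) = p / gcd(p, v_P(f))`) together with Thm. 3.7.1 (transitivity of the Galois group on the
places above `P`) for the extension `L(C_f)/L(x)`, proved here by the elementary count above
rather than through Kummer's theorem and Hilbert theory.  Everything is proved; no named facts, no
new definitions.

## References

* H. Stichtenoth, *Algebraic Function Fields and Codes*, 2nd ed., GTM 254 (2009), Thm. 3.1.11,
  Thm. 3.7.1, Prop. 3.7.3. [Stichtenoth2009]
* E. F. Schaefer, *Computing a Selmer group of a Jacobian using functions on the curve*,
  Math. Ann. 310 (1998) 447–471, §3. [Schaefer1998]
-/

noncomputable section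

open Polynomial
open scoped Classical

namespace Literature.NumberTheory.GaloisRepresentations

open Literature.NumberTheory.DiophantineGeometry Literature.NumberTheory.DiophantineGeometry.AlgFunctionField

universe u v w

/-- `val (ζ⁻¹) = (val ζ)⁻¹` for a deck transformation. [folklore] -/
theorem CyclicCoverDeck.val_inv {L : Type v} [Field L] {m : ℕ} (ζ : CyclicCoverDeck L m) :
    (ζ⁻¹).val = ζ.val⁻¹ := by
  have h1 : (ζ⁻¹).val * ζ.val = 1 := by rw [← CyclicCoverDeck.val_mul, inv_mul_cancel, CyclicCoverDeck.val_one]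
  have h0 : ζ.val ≠ 0 := fun h => by rw [h, mul_zero] at h1; exact zero_ne_one h1
  exact (eq_inv_of_mul_eq_one_left h1)

/-- `val ζ ≠ 0`. [folklore] -/
theorem CyclicCoverDeck.val_ne_zero {L : Type v} [Field L] {m : ℕ} (ζ : CyclicCoverDeck L m) : ζ.val ≠ 0 := by
  have h1 : (ζ⁻¹).val * ζ.val = 1 := by rw [← CyclicCoverDeck.val_mul, inv_mul_cancel, CyclicCoverDeck.val_one]
  exact fun h => by rw [h, mul_zero] at h1; exact zero_ne_one h1

namespace SuperellipticFunctionField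

variable {K : Type u} [Field K] {L : Type v} [Field L] [Algebra K L] {p : ℕ} {f : K[X]}
variable [Fact (Irreducible (superellipticPoly K L p f))]

/-! ### Transport of `u ≡ b (mod Q)` under automorphisms -/

/-- `v_{g Q}(g z) < 1 ↔ v_Q(z) < 1`: automorphisms transport the maximal ideals of the places.
[cite: Stichtenoth2009, Lemma 3.5.2] -/
theorem valuation_smul_smul_lt_one_iff {G : Type w} [Group G]
    [MulSemiringAction G (SuperellipticFunctionField K L p f)]
    [IsConstantStable G L (SuperellipticFunctionField K L p f)] (g : G)
    (Q : PlaceOver L (SuperellipticFunctionField K L p f)) (z : SuperellipticFunctionField K L p f) :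
    (g • Q).valuation (g • z) < 1 ↔ Q.valuation z < 1 := by
  rcases eq_or_ne z 0 with rfl | hz
  · simp
  rw [valuation_lt_one_iff_inv_notMem _ ((smul_ne_zero_iff_ne g).2 hz),
    valuation_lt_one_iff_inv_notMem _ hz, ← smul_inv'', toValuationSubring_smul,
    ValuationSubring.smul_mem_pointwise_smul_iff]

/-- The deck transformations fix the constants. [folklore] -/
theorem deck_smul_algebraMap (ζ : CyclicCoverDeck L p) (b : L) :
    ζ • algebraMap L (SuperellipticFunctionField K L p f) b = algebraMap L _ b :=
  deckAlgHom_algebraMap K L p f ζ b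

/-- **Labels shift under the deck group**: if `u ≡ b (mod Q)` and `ζ u = ζ · u` then
`u ≡ ζ⁻¹ b (mod ζ Q)`. [cite: Schaefer1998, §3] -/
theorem valuation_deck_smul_sub_lt_one {Q : PlaceOver L (SuperellipticFunctionField K L p f)}
    {u : SuperellipticFunctionField K L p f}
    (hζu : ∀ ζ : CyclicCoverDeck L p, ζ • u = algebraMap L _ ζ.val * u) {b : L}
    (h : Q.valuation (u - algebraMap L _ b) < 1) (ζ : CyclicCoverDeck L p) :
    (ζ • Q).valuation (u - algebraMap L _ (ζ.val⁻¹ * b)) < 1 := by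
  have h1 : (ζ • Q).valuation (ζ • (u - algebraMap L _ b)) < 1 := (valuation_smul_smul_lt_one_iff ζ Q _).2 h
  rw [smul_sub, hζu, deck_smul_algebraMap] at h1
  have hz : algebraMap L (SuperellipticFunctionField K L p f) ζ.val ≠ 0 :=
    (_root_.map_ne_zero _).2 (CyclicCoverDeck.val_ne_zero ζ)
  have heq : u - algebraMap L _ (ζ.val⁻¹ * b) =
      (algebraMap L (SuperellipticFunctionField K L p f) ζ.val)⁻¹ *
        (algebraMap L _ ζ.val * u - algebraMap L _ b) := by
    rw [map_mul, map_inv₀, mul_sub, ← mul_assoc, inv_mul_cancel₀ hz, one_mul]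
  rw [heq, map_mul, map_inv₀, PlaceOver.valuation_algebraMap_eq_one _ (CyclicCoverDeck.val_ne_zero ζ),
    inv_one, one_mul]
  exact h1

/-! ### The labelling argument -/

/-- **The fibre of an unramified point of the cyclic cover** (labelling argument, see the module
docstring): if `P` is rational and `u ∈ L(C_f)`, `c ∈ L^×` satisfy `u ∈ O_Q`, `u^p ≡ c (mod Q)` for all
`Q | P` and `ζ u = ζ · u` for the deck group, and `L ∋ ζ₀` (primitive `p`-th root of unity), `b₀`
(`b₀^p = c`), then every place above `P` has `e(Q|P) = 1`, any two places above `P` are conjugate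
under the deck group, and there are exactly `p` of them (Stichtenoth Prop. 3.7.3 with Thm. 3.7.1 for
`L(C_f)/L(x)`). [cite: Stichtenoth2009, Prop. 3.7.3 and Thm. 3.7.1] -/
theorem fibre_spec [hp : Fact p.Prime] {ζ₀ : L} (hζ₀ : IsPrimitiveRoot ζ₀ p)
    {P : PlaceOver L (RatFunc L)} (hP : P.degree = 1)
    {u : SuperellipticFunctionField K L p f} {c b₀ : L} (hc : c ≠ 0) (hb₀ : b₀ ^ p = c)
    (hu : ∀ Q : PlaceOver L (SuperellipticFunctionField K L p f),
      Q.restrict (K := L) (F := RatFunc L) = P →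
        u ∈ Q.toValuationSubring ∧ Q.valuation (u ^ p - algebraMap L _ c) < 1)
    (hζu : ∀ ζ : CyclicCoverDeck L p, ζ • u = algebraMap L _ ζ.val * u) :
    (∀ Q : PlaceOver L (SuperellipticFunctionField K L p f),
        Q.restrict (K := L) (F := RatFunc L) = P → ramificationIdx K L p f Q = 1) ∧
      (∀ Q Q' : PlaceOver L (SuperellipticFunctionField K L p f),
        Q.restrict (K := L) (F := RatFunc L) = P → Q'.restrict (K := L) (F := RatFunc L) = P →
          ∃ ζ : CyclicCoverDeck L p, ζ • Q = Q') ∧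
      (P.finite_setOf_restrict_eq (F' := SuperellipticFunctionField K L p f)).toFinset.card = p := by
  set ι := algebraMap L (SuperellipticFunctionField K L p f) with hι
  have hp0 : 0 < p := hp.out.pos
  have hb₀0 : b₀ ≠ 0 := by
    rintro rfl
    rw [zero_pow hp.out.ne_zero] at hb₀
    exact hc hb₀.symm
  have hζ₀' : IsPrimitiveRoot (ι ζ₀) p := hζ₀.map_of_injective (algebraMap L _).injective
  -- `u^p - c = ∏ (u - ζ₀^i b₀)`
  have hprod : ∀ z : SuperellipticFunctionField K L p f,
      ∏ i ∈ Finset.range p, (z - ι (ζ₀ ^ i * b₀)) = z ^ p - ι c := by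
    intro z
    have h := X_pow_sub_C_eq_prod hζ₀' hp0 (show ι b₀ ^ p = ι c by rw [← map_pow, hb₀])
    have h2 := congrArg (eval z) h
    rw [eval_sub, eval_pow, eval_X, eval_C, eval_prod] at h2
    rw [h2]
    refine Finset.prod_congr rfl fun i _ => ?_
    rw [eval_sub, eval_X, eval_C, map_mul, map_pow]
  -- existence of a label
  have hex : ∀ Q : PlaceOver L (SuperellipticFunctionField K L p f),
      Q.restrict (K := L) (F := RatFunc L) = P → ∃ i, i < p ∧ Q.valuation (u - ι (ζ₀ ^ i * b₀)) < 1 := by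
    intro Q hQ
    obtain ⟨huQ, hlt⟩ := hu Q hQ
    rw [← hprod u, map_prod] at hlt
    by_contra hne
    push Not at hne
    have hall : ∀ i ∈ Finset.range p, Q.valuation (u - ι (ζ₀ ^ i * b₀)) = 1 := fun i hi =>
      le_antisymm ((Q.toValuationSubring.valuation_le_one_iff _).2 (sub_mem huQ (Q.algebraMap_mem _)))
        (hne i (Finset.mem_range.1 hi))
    rw [Finset.prod_eq_one hall] at hlt
    exact lt_irrefl _ hlt
  -- uniqueness of the label
  have huniq : ∀ (Q : PlaceOver L (SuperellipticFunctionField K L p f)) (b b' : L),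
      Q.valuation (u - ι b) < 1 → Q.valuation (u - ι b') < 1 → b = b' := by
    intro Q b b' h h'
    by_contra hne
    have h1 : Q.valuation ((u - ι b') - (u - ι b)) < 1 :=
      lt_of_le_of_lt (Valuation.map_sub _ _ _) (max_lt h' h)
    rw [sub_sub_sub_cancel_left, ← map_sub, PlaceOver.valuation_algebraMap_eq_one Q (sub_ne_zero.2 hne)] at h1
    exact lt_irrefl _ h1
  -- the deck transformations `ζ₀^j`
  let δ : ℕ → CyclicCoverDeck L p := fun j => CyclicCoverDeck.equivRootsOfUnity.symm
    (rootsOfUnity.mkOfPowEq (ζ₀ ^ j) (by rw [← pow_mul, mul_comm, pow_mul, hζ₀.pow_eq_one, one_pow]))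
  have hδ : ∀ j, (δ j).val = ζ₀ ^ j := fun j => rfl
  -- a base place above `P` and its translates
  obtain ⟨Q₀, hQ₀⟩ := PlaceOver.exists_restrict_eq' (K := L) (F := RatFunc L)
    (F' := SuperellipticFunctionField K L p f) P
  obtain ⟨i₀, -, hlab₀⟩ := hex Q₀ hQ₀
  set b := ζ₀ ^ i₀ * b₀ with hb
  have hbne : b ≠ 0 := mul_ne_zero (pow_ne_zero _ (hζ₀.ne_zero hp.out.ne_zero)) hb₀0
  have hshift : ∀ j, ((δ j)⁻¹ • Q₀).valuation (u - ι (ζ₀ ^ j * b)) < 1 := by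
    intro j
    have h := valuation_deck_smul_sub_lt_one hζu hlab₀ (δ j)⁻¹
    rwa [CyclicCoverDeck.val_inv, inv_inv, hδ] at h
  set S := (P.finite_setOf_restrict_eq (F' := SuperellipticFunctionField K L p f)).toFinset with hS
  have hmemS : ∀ Q, Q ∈ S ↔ Q.restrict (K := L) (F := RatFunc L) = P := fun Q =>
    P.mem_toFinset_restrict_eq_iff Q
  let q : ℕ → PlaceOver L (SuperellipticFunctionField K L p f) := fun j => (δ j)⁻¹ • Q₀
  have hqS : ∀ j, q j ∈ S := fun j => (hmemS _).2 (by
    show ((δ j)⁻¹ • Q₀).restrict (K := L) (F := RatFunc L) = P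
    rw [restrict_deck_smul, hQ₀])
  have hqinj : ∀ j j', j < p → j' < p → q j = q j' → j = j' := by
    intro j j' hj hj' h
    have h1 := hshift j
    have h2 := hshift j'
    change (q j).valuation _ < 1 at h1
    change (q j').valuation _ < 1 at h2
    rw [h] at h1
    exact hζ₀.pow_inj hj hj' (mul_right_cancel₀ hbne (huniq _ _ _ h1 h2))
  have himg : ((Finset.range p).image q).card = p := by
    rw [Finset.card_image_of_injOn (fun j hj j' hj' h => hqinj j j'
      (Finset.mem_range.1 (Finset.mem_coe.1 hj)) (Finset.mem_range.1 (Finset.mem_coe.1 hj')) h),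
      Finset.card_range]
  have hsub : (Finset.range p).image q ⊆ S := Finset.image_subset_iff.2 fun j _ => hqS j
  have hcard_le : p ≤ S.card := by
    have h := Finset.card_le_card hsub
    rwa [himg] at h
  -- the fundamental equality
  have hsum := PlaceOver.sum_ramification_mul_degree_eq (K := L) (F := RatFunc L) P S hmemS
  rw [finrank_eq K L p f, hP, Nat.cast_one, mul_one] at hsum
  have hterm : ∀ Q ∈ S, 1 ≤ Q.ord (algebraMap (RatFunc L) (SuperellipticFunctionField K L p f)
      (P.uniformizer : RatFunc L)) * (Q.degree : ℤ) := fun Q hQ => by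
    rw [← ramificationIdx_eq_of_restrict_eq ((hmemS Q).1 hQ)]
    have h1 := one_le_ramificationIdx Q
    have h2 : (1 : ℤ) ≤ Q.degree := by exact_mod_cast PlaceOver.degree_pos_holds Q
    nlinarith
  have hcard_ge : (S.card : ℤ) ≤ p := by
    calc (S.card : ℤ) = ∑ Q ∈ S, (1 : ℤ) := by simp
      _ ≤ ∑ Q ∈ S, Q.ord (algebraMap (RatFunc L) (SuperellipticFunctionField K L p f)
            (P.uniformizer : RatFunc L)) * (Q.degree : ℤ) := Finset.sum_le_sum hterm
      _ = p := hsum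
  have hcard : S.card = p := by
    have : (S.card : ℤ) = p := le_antisymm hcard_ge (by exact_mod_cast hcard_le)
    exact_mod_cast this
  have hterm1 : ∀ Q ∈ S, Q.ord (algebraMap (RatFunc L) (SuperellipticFunctionField K L p f)
      (P.uniformizer : RatFunc L)) * (Q.degree : ℤ) = 1 := by
    have h0 : ∑ Q ∈ S, (Q.ord (algebraMap (RatFunc L) (SuperellipticFunctionField K L p f)
        (P.uniformizer : RatFunc L)) * (Q.degree : ℤ) - 1) = 0 := by
      rw [Finset.sum_sub_distrib, hsum, Finset.sum_const, nsmul_eq_mul, mul_one, hcard, sub_self]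
    intro Q hQ
    have := (Finset.sum_eq_zero_iff_of_nonneg (fun Q hQ => sub_nonneg.2 (hterm Q hQ))).1 h0 Q hQ
    linarith
  have he1 : ∀ Q : PlaceOver L (SuperellipticFunctionField K L p f),
      Q.restrict (K := L) (F := RatFunc L) = P → ramificationIdx K L p f Q = 1 := by
    intro Q hQ
    have h := hterm1 Q ((hmemS Q).2 hQ)
    rw [← ramificationIdx_eq_of_restrict_eq hQ] at h
    have h1 := one_le_ramificationIdx Q
    exact Int.eq_one_of_mul_eq_one_right (by omega) h
  -- one orbit
  have hSeq : (Finset.range p).image q = S :=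
    Finset.eq_of_subset_of_card_le hsub (by rw [hcard, himg])
  have htrans : ∀ Q Q' : PlaceOver L (SuperellipticFunctionField K L p f),
      Q.restrict (K := L) (F := RatFunc L) = P → Q'.restrict (K := L) (F := RatFunc L) = P →
        ∃ ζ : CyclicCoverDeck L p, ζ • Q = Q' := by
    intro Q Q' hQ hQ'
    have hQm : Q ∈ (Finset.range p).image q := hSeq ▸ (hmemS Q).2 hQ
    have hQm' : Q' ∈ (Finset.range p).image q := hSeq ▸ (hmemS Q').2 hQ'
    obtain ⟨j, -, rfl⟩ := Finset.mem_image.1 hQm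
    obtain ⟨j', -, rfl⟩ := Finset.mem_image.1 hQm'
    exact ⟨(δ j')⁻¹ * δ j, by change ((δ j')⁻¹ * δ j) • (δ j)⁻¹ • Q₀ = (δ j')⁻¹ • Q₀; rw [mul_smul, smul_inv_smul]⟩
  exact ⟨he1, htrans, hcard⟩

/-! ### The fibres above the non-roots `β`, `f(β) ≠ 0` -/

section NonRoot

variable [hp : Fact p.Prime]

/-- Above `P_β` with `f(β) ≠ 0`: `y ∈ O_Q` and `y^p ≡ f(β) (mod Q)` (`y^p - f(β) = (x - β) h(x)`).
[cite: Schaefer1998, §3] -/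
theorem genY_mem_and_valuation_lt_one_of_eval_ne_zero {β : L} (hβ : (f.map (algebraMap K L)).eval β ≠ 0)
    {Q : PlaceOver L (SuperellipticFunctionField K L p f)}
    (hQ : Q.restrict (K := L) (F := RatFunc L) = placeXSubC β) :
    genY K L p f ∈ Q.toValuationSubring ∧
      Q.valuation (genY K L p f ^ p - algebraMap L _ ((f.map (algebraMap K L)).eval β)) < 1 := by
  have hf0 : f ≠ 0 := by rintro rfl; exact hβ (by rw [Polynomial.map_zero, eval_zero])
  have hy0 : genY K L p f ≠ 0 := genY_ne_zero hp.out.ne_zero hf0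
  -- `p v_Q(y) = e · v_β(f) = 0`
  have hord : Q.ord (genY K L p f) = 0 := by
    have h := natCast_mul_ord_genY hp.out.ne_zero hf0 Q
    rw [hQ, ord_placeXSubC_algebraMap_of_eval_ne_zero β hβ, mul_zero] at h
    have hp0 : (p : ℤ) ≠ 0 := by exact_mod_cast hp.out.ne_zero
    exact (mul_eq_zero.1 h).resolve_left hp0
  refine ⟨(Q.mem_toValuationSubring_iff_ord_nonneg hy0).2 hord.ge, ?_⟩
  -- `y^p - f(β) = (x - β) · h(x)`
  obtain ⟨h, hh⟩ := X_sub_C_dvd_sub_C_eval (p := f.map (algebraMap K L)) (a := β)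
  have heq : genY K L p f ^ p - algebraMap L _ ((f.map (algebraMap K L)).eval β) =
      (genX K L p f - algebraMap L _ β) * aeval (genX K L p f) h := by
    have h1 := congrArg (aeval (genX K L p f)) hh
    rw [map_sub, aeval_C, map_mul, map_sub, aeval_X, aeval_C] at h1
    rw [genY_pow_eq_aeval, h1]
  rw [heq, map_mul]
  have hx : Q.valuation (genX K L p f - algebraMap L _ β) < 1 :=
    (Q.valuation_lt_one_iff_ord_pos (genX_sub_algebraMap_ne_zero K L p f β)).2 (ord_pos_of_restrict_eq_placeXSubC hQ)
  have hh1 : Q.valuation (aeval (genX K L p f) h) ≤ 1 :=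
    (Q.toValuationSubring.valuation_le_one_iff _).2 (aeval_genX_mem_of_restrict_eq_placeXSubC hQ h)
  calc Q.valuation (genX K L p f - algebraMap L _ β) * Q.valuation (aeval (genX K L p f) h)
      ≤ Q.valuation (genX K L p f - algebraMap L _ β) * 1 := mul_le_mul_right hh1 _
    _ < 1 := by rw [mul_one]; exact hx

omit hp in
/-- The deck transformations act on `y` by `ζ`. [folklore] -/
theorem deck_smul_genY (ζ : CyclicCoverDeck L p) :
    ζ • genY K L p f = algebraMap L _ ζ.val * genY K L p f :=
  deck_smul_root K L p f ζ

variable [IsAlgClosed L]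

/-- **The fibre above a non-root is unramified**: `e(Q | P_β) = 1` for `f(β) ≠ 0`
(Stichtenoth Prop. 3.7.3 (b) with `v_β(f) = 0`). [cite: Stichtenoth2009, Prop. 3.7.3] -/
theorem ramificationIdx_eq_one_of_eval_ne_zero {ζ₀ : L} (hζ₀ : IsPrimitiveRoot ζ₀ p) {β : L}
    (hβ : (f.map (algebraMap K L)).eval β ≠ 0) {Q : PlaceOver L (SuperellipticFunctionField K L p f)}
    (hQ : Q.restrict (K := L) (F := RatFunc L) = placeXSubC β) : ramificationIdx K L p f Q = 1 := by
  obtain ⟨b₀, hb₀⟩ := IsAlgClosed.exists_pow_nat_eq ((f.map (algebraMap K L)).eval β) hp.out.pos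
  exact (fibre_spec hζ₀ (isRational_placeXSubC β) hβ hb₀
    (fun Q hQ => genY_mem_and_valuation_lt_one_of_eval_ne_zero hβ hQ) deck_smul_genY).1 Q hQ

/-- **The deck group is transitive on the fibre above a non-root** (Stichtenoth Thm. 3.7.1 for the
Galois extension `L(C_f)/L(x)`). [cite: Stichtenoth2009, Thm. 3.7.1] -/
theorem exists_deck_smul_eq_of_eval_ne_zero {ζ₀ : L} (hζ₀ : IsPrimitiveRoot ζ₀ p) {β : L}
    (hβ : (f.map (algebraMap K L)).eval β ≠ 0) {Q Q' : PlaceOver L (SuperellipticFunctionField K L p f)}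
    (hQ : Q.restrict (K := L) (F := RatFunc L) = placeXSubC β)
    (hQ' : Q'.restrict (K := L) (F := RatFunc L) = placeXSubC β) :
    ∃ ζ : CyclicCoverDeck L p, ζ • Q = Q' := by
  obtain ⟨b₀, hb₀⟩ := IsAlgClosed.exists_pow_nat_eq ((f.map (algebraMap K L)).eval β) hp.out.pos
  exact (fibre_spec hζ₀ (isRational_placeXSubC β) hβ hb₀
    (fun Q hQ => genY_mem_and_valuation_lt_one_of_eval_ne_zero hβ hQ) deck_smul_genY).2.1 Q Q' hQ hQ'

/-- There are exactly `p` places above a non-root. [cite: Stichtenoth2009, Prop. 3.7.3] -/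
theorem card_fibre_of_eval_ne_zero {ζ₀ : L} (hζ₀ : IsPrimitiveRoot ζ₀ p) {β : L}
    (hβ : (f.map (algebraMap K L)).eval β ≠ 0) :
    ((placeXSubC β).finite_setOf_restrict_eq (F' := SuperellipticFunctionField K L p f)).toFinset.card = p := by
  obtain ⟨b₀, hb₀⟩ := IsAlgClosed.exists_pow_nat_eq ((f.map (algebraMap K L)).eval β) hp.out.pos
  exact (fibre_spec hζ₀ (isRational_placeXSubC β) hβ hb₀
    (fun Q hQ => genY_mem_and_valuation_lt_one_of_eval_ne_zero hβ hQ) deck_smul_genY).2.2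

end NonRoot

/-! ### The fibre above `∞` (`p ∣ deg f`) -/

section Infinity

variable [hp : Fact p.Prime]

/-- Above `P_∞`, with `deg f = pk`: `u = y/x^k ∈ O_Q` and `u^p ≡ lead f (mod Q)`
(`u^p - lead f = (f(x) - lead f · x^{pk}) / x^{pk}` has positive order). [cite: PoonenSchaefer1997, §5] -/
theorem genYdivXpow_mem_and_valuation_lt_one {k : ℕ} (hdeg : f.natDegree = p * k) (hf : f ≠ 0)
    {Q : PlaceOver L (SuperellipticFunctionField K L p f)}
    (hQ : Q.restrict (K := L) (F := RatFunc L) = ratFuncInftyPlace L) :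
    genY K L p f * (genX K L p f)⁻¹ ^ k ∈ Q.toValuationSubring ∧
      Q.valuation ((genY K L p f * (genX K L p f)⁻¹ ^ k) ^ p -
        algebraMap L _ ((f.map (algebraMap K L)).leadingCoeff)) < 1 := by
  set x := genX K L p f with hx
  set y := genY K L p f with hy
  set g := f.map (algebraMap K L) with hg
  set e := ramificationIdx K L p f Q with he
  have hg0 : g ≠ 0 := (Polynomial.map_ne_zero_iff (algebraMap K L).injective).2 hf
  have hgdeg : g.natDegree = p * k := by rw [hg, natDegree_map, hdeg]
  have hx0 : x ≠ 0 := fun h => transcendental_genX K L p f (by rw [← hx, h]; exact isAlgebraic_zero)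
  have hy0 : y ≠ 0 := genY_ne_zero hp.out.ne_zero hf
  have hp0 : (p : ℤ) ≠ 0 := by exact_mod_cast hp.out.ne_zero
  have hordx : Q.ord x = -e := ord_genX_of_restrict_eq_inftyPlace hQ
  have hordy : Q.ord y = -(e * k) := by
    have h := natCast_mul_ord_genY hp.out.ne_zero hf Q
    rw [hQ, ord_ratFuncInftyPlace_algebraMap L hg0, hgdeg] at h
    push_cast at h
    have : (p : ℤ) * Q.ord y = p * (-(e * k)) := by rw [h]; ring
    exact mul_left_cancel₀ hp0 this
  have hordu : Q.ord (y * x⁻¹ ^ k) = 0 := by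
    rw [Q.ord_mul_eq hy0 (pow_ne_zero _ (inv_ne_zero hx0)), Q.ord_pow (inv_ne_zero hx0), Q.ord_inv hx0,
      hordx, hordy]
    ring
  refine ⟨(Q.mem_toValuationSubring_iff_ord_nonneg (mul_ne_zero hy0 (pow_ne_zero _ (inv_ne_zero hx0)))).2
    hordu.ge, ?_⟩
  -- `u^p - c = (g(x) - c x^{pk}) · x^{-pk}` with `g - c X^{pk} = eraseLead g`
  set r := g.eraseLead with hr
  have hgr : g = r + C g.leadingCoeff * X ^ (p * k) := by
    rw [hr, ← hgdeg, C_mul_X_pow_eq_monomial, eraseLead_add_monomial_natDegree_leadingCoeff]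
  have hxpk : x ^ (p * k) ≠ 0 := pow_ne_zero _ hx0
  have hu : (y * x⁻¹ ^ k) ^ p - algebraMap L _ g.leadingCoeff = aeval x r * (x ^ (p * k))⁻¹ := by
    have h1 : y ^ p = aeval x g := genY_pow_eq_aeval K L p f
    rw [hgr, map_add, map_mul, aeval_C, map_pow, aeval_X] at h1
    rw [mul_pow, h1, ← pow_mul, mul_comm k p, inv_pow]
    field_simp
    ring
  rw [hu]
  rcases eq_or_ne r 0 with hr0 | hr0
  · rw [hr0, map_zero, zero_mul, Valuation.map_zero]; exact zero_lt_one
  · have hrdeg : r.natDegree < p * k := by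
      rw [← hgdeg]; exact natDegree_lt_natDegree hr0 (degree_eraseLead_lt hg0)
    have hr' : aeval x r ≠ 0 := by
      rw [aeval_genX]; exact (map_ne_zero_iff _ (algebraMap_polynomial_injective K L p f)).2 hr0
    refine (Q.valuation_lt_one_iff_ord_pos (mul_ne_zero hr' (inv_ne_zero hxpk))).2 ?_
    rw [Q.ord_mul_eq hr' (inv_ne_zero hxpk), Q.ord_inv hxpk, Q.ord_pow hx0, hordx, aeval_genX,
      IsScalarTower.algebraMap_apply L[X] (RatFunc L) (SuperellipticFunctionField K L p f),
      ord_algebraMap_ratFunc, hQ, ord_ratFuncInftyPlace_algebraMap L hr0, ← he]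
    have h1 := one_le_ramificationIdx Q
    rw [← he] at h1
    have : (r.natDegree : ℤ) < p * k := by exact_mod_cast hrdeg
    push_cast
    nlinarith

omit hp in
/-- The deck transformations act on `y/x^k` by `ζ`. [folklore] -/
theorem deck_smul_genYdivXpow (k : ℕ) (ζ : CyclicCoverDeck L p) :
    ζ • (genY K L p f * (genX K L p f)⁻¹ ^ k) = algebraMap L _ ζ.val * (genY K L p f * (genX K L p f)⁻¹ ^ k) := by
  rw [smul_mul', smul_pow', smul_inv'', genX_eq_algebraMap_ratFunc, deck_smul_algebraMap_ratFunc,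
    deck_smul_genY, mul_assoc]

variable [IsAlgClosed L]

/-- **The fibre above `∞` is unramified when `p ∣ deg f`**: `e(Q | P_∞) = 1`
(Stichtenoth Prop. 3.7.3 (b): `v_∞(f) = -deg f ≡ 0 mod p`). [cite: Stichtenoth2009, Prop. 3.7.3] -/
theorem ramificationIdx_eq_one_of_restrict_eq_inftyPlace {ζ₀ : L} (hζ₀ : IsPrimitiveRoot ζ₀ p)
    (hdvd : p ∣ f.natDegree) (hf : f ≠ 0) {Q : PlaceOver L (SuperellipticFunctionField K L p f)}
    (hQ : Q.restrict (K := L) (F := RatFunc L) = ratFuncInftyPlace L) : ramificationIdx K L p f Q = 1 := by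
  obtain ⟨k, hk⟩ := hdvd
  have hc : (f.map (algebraMap K L)).leadingCoeff ≠ 0 :=
    leadingCoeff_ne_zero.2 ((Polynomial.map_ne_zero_iff (algebraMap K L).injective).2 hf)
  obtain ⟨b₀, hb₀⟩ := IsAlgClosed.exists_pow_nat_eq ((f.map (algebraMap K L)).leadingCoeff) hp.out.pos
  exact (fibre_spec hζ₀ (degree_ratFuncInftyPlace (K := L)) hc hb₀
    (fun Q hQ => genYdivXpow_mem_and_valuation_lt_one hk hf hQ) (deck_smul_genYdivXpow k)).1 Q hQ

/-- **The deck group is transitive on the fibre above `∞`** (`p ∣ deg f`).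
[cite: Stichtenoth2009, Thm. 3.7.1] -/
theorem exists_deck_smul_eq_of_restrict_eq_inftyPlace {ζ₀ : L} (hζ₀ : IsPrimitiveRoot ζ₀ p)
    (hdvd : p ∣ f.natDegree) (hf : f ≠ 0) {Q Q' : PlaceOver L (SuperellipticFunctionField K L p f)}
    (hQ : Q.restrict (K := L) (F := RatFunc L) = ratFuncInftyPlace L)
    (hQ' : Q'.restrict (K := L) (F := RatFunc L) = ratFuncInftyPlace L) :
    ∃ ζ : CyclicCoverDeck L p, ζ • Q = Q' := by
  obtain ⟨k, hk⟩ := hdvd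
  have hc : (f.map (algebraMap K L)).leadingCoeff ≠ 0 :=
    leadingCoeff_ne_zero.2 ((Polynomial.map_ne_zero_iff (algebraMap K L).injective).2 hf)
  obtain ⟨b₀, hb₀⟩ := IsAlgClosed.exists_pow_nat_eq ((f.map (algebraMap K L)).leadingCoeff) hp.out.pos
  exact (fibre_spec hζ₀ (degree_ratFuncInftyPlace (K := L)) hc hb₀
    (fun Q hQ => genYdivXpow_mem_and_valuation_lt_one hk hf hQ) (deck_smul_genYdivXpow k)).2.1 Q Q' hQ hQ'

/-- There are exactly `p` places above `∞` (`p ∣ deg f`). [cite: Stichtenoth2009, Prop. 3.7.3] -/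
theorem card_fibre_inftyPlace {ζ₀ : L} (hζ₀ : IsPrimitiveRoot ζ₀ p) (hdvd : p ∣ f.natDegree) (hf : f ≠ 0) :
    ((ratFuncInftyPlace L).finite_setOf_restrict_eq (F' := SuperellipticFunctionField K L p f)).toFinset.card = p := by
  obtain ⟨k, hk⟩ := hdvd
  have hc : (f.map (algebraMap K L)).leadingCoeff ≠ 0 :=
    leadingCoeff_ne_zero.2 ((Polynomial.map_ne_zero_iff (algebraMap K L).injective).2 hf)
  obtain ⟨b₀, hb₀⟩ := IsAlgClosed.exists_pow_nat_eq ((f.map (algebraMap K L)).leadingCoeff) hp.out.pos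
  exact (fibre_spec hζ₀ (degree_ratFuncInftyPlace (K := L)) hc hb₀
    (fun Q hQ => genYdivXpow_mem_and_valuation_lt_one hk hf hQ) (deck_smul_genYdivXpow k)).2.2

end Infinity

end SuperellipticFunctionField

end Literature.NumberTheory.GaloisRepresentations

/-!
## Part 3. Divisors on the superelliptic curve `y^p = f(x)`: `(x - α)`, `(y)`, fibre divisors, and the
# structure of the divisors invariant under the deck group

Third file of the proof of `superelliptic_lambdaTorsion_iso_heart` (setting of
`SuperellipticRamification`, `SuperellipticFibres`: `L` algebraically closed, `p` prime with a
primitive `p`-th root of unity `ζ₀ ∈ L`, `f ∈ K[X]` separable with `p ∣ deg f = pk`,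
`L(C_f) = SuperellipticFunctionField K L p f`, `T_α = rootPlace α` the place above a root `α`).
Following Schaefer (Math. Ann. 310, §3) and Poonen–Schaefer (§§5–6):

* `fibreDivisor P = ∑_{Q | P} Q` — the pull-back to `C_f` of the point `P` of `ℙ¹_L` when `P` is
  not below a ramification place (`deg = p`, `degree_fibreDivisor`);
* **the principal divisors of the basic functions** (`principalDivisor_genX_sub_of_isRoot`:
  `(x - α) = p T_α - fibreDivisor ∞`; `principalDivisor_genX_sub_of_eval_ne_zero`:
  `(x - β) = fibreDivisor P_β - fibreDivisor ∞`; `principalDivisor_genY`: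
  `(y) = ∑_α T_α - k · fibreDivisor ∞`);
* consequences in `Princ(L(C_f)/L)`: `p (T_α - T_β) ∼ 0` (`smul_single_sub_single_mem`),
  `∑_α (T_α - T_{α₀}) ∼ 0` (`sum_single_sub_single_mem`), `fibreDivisor P ∼ p T_{α₀}`
  (`fibreDivisor_sub_mem`);
* **deck-invariant divisors** (`sub_sum_smul_sub_degree_smul_mem_of_invariant`): a divisor `D`
  fixed by the deck group is, modulo principal divisors,
  `∑_α D(T_α) (T_α - T_{α₀}) + (deg D) T_{α₀}` — because off the `T_α` it is constant along the
  fibres (one deck orbit each, `SuperellipticFibres`), i.e. a combination of fibre divisors.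

Everything is proved; the only definition (`fibreDivisor`) is genuine.

## References

* E. F. Schaefer, *Computing a Selmer group of a Jacobian using functions on the curve*,
  Math. Ann. 310 (1998) 447–471, §3 (Prop. 3.2–3.4). [Schaefer1998]
* B. Poonen, E. F. Schaefer, *Explicit descent for Jacobians of cyclic covers of the projective
  line*, J. reine angew. Math. 488 (1997) 141–188, §§5–6. [PoonenSchaefer1997]
-/

noncomputable section

open Polynomial
open scoped Classical

namespace Literature.NumberTheory.GaloisRepresentations

open Literature.NumberTheory.DiophantineGeometry Literature.NumberTheory.DiophantineGeometry.AlgFunctionField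

universe u v w

attribute [local instance] Finsupp.comapSMul Finsupp.comapMulAction Finsupp.comapDistribMulAction

namespace SuperellipticFunctionField

variable {K : Type u} [Field K] {L : Type v} [Field L] [Algebra K L] {p : ℕ} {f : K[X]}
variable [Fact (Irreducible (superellipticPoly K L p f))]

/-! ### Roots -/

omit [Fact (Irreducible (superellipticPoly K L p f))] in
/-- Elements of the root set are roots of `f` over `L`. [folklore] -/
theorem isRoot_of_mem_rootSet {α : L} (h : α ∈ f.rootSet L) : (f.map (algebraMap K L)).IsRoot α := by
  rw [mem_rootSet] at h
  rw [IsRoot.def, eval_map, ← aeval_def]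
  exact h.2

omit [Fact (Irreducible (superellipticPoly K L p f))] in
/-- Roots of `f` over `L` lie in the root set (`f ≠ 0`). [folklore] -/
theorem mem_rootSet_of_isRoot (hf : f ≠ 0) {α : L} (h : (f.map (algebraMap K L)).IsRoot α) :
    α ∈ f.rootSet L := by
  rw [mem_rootSet, aeval_def, ← eval_map]
  exact ⟨hf, h⟩

/-! ### Fibre divisors -/

variable (K L p f) in
/-- **The fibre divisor `∑_{Q | P} Q`** of a place `P` of `L(x)`: the reduced pull-back of the point
`P ∈ ℙ¹` to the curve `C_f` (for `P` unramified this is the conorm of `P`). [cite: Schaefer1998, §3] -/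
def fibreDivisor (P : PlaceOver L (RatFunc L)) : Divisor L (SuperellipticFunctionField K L p f) :=
  ∑ Q ∈ (P.finite_setOf_restrict_eq (F' := SuperellipticFunctionField K L p f)).toFinset, Finsupp.single Q 1

/-- Coefficients of the fibre divisor. [folklore] -/
theorem fibreDivisor_apply (P : PlaceOver L (RatFunc L)) (Q : PlaceOver L (SuperellipticFunctionField K L p f)) :
    fibreDivisor K L p f P Q = if Q.restrict (K := L) (F := RatFunc L) = P then 1 else 0 := by
  rw [fibreDivisor, Finsupp.finsetSum_apply]
  simp only [Finsupp.single_apply]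
  rw [Finset.sum_ite_eq']
  by_cases h : Q.restrict (K := L) (F := RatFunc L) = P
  · rw [if_pos ((P.mem_toFinset_restrict_eq_iff Q).2 h), if_pos h]
  · rw [if_neg (fun h' => h ((P.mem_toFinset_restrict_eq_iff Q).1 h')), if_neg h]

/-- The degree of a fibre divisor over an algebraically closed field is the number of places above
`P`. [folklore] -/
theorem degree_fibreDivisor_eq_card [IsAlgClosed L] (P : PlaceOver L (RatFunc L)) :
    (fibreDivisor K L p f P).degree =
      (P.finite_setOf_restrict_eq (F' := SuperellipticFunctionField K L p f)).toFinset.card := by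
  rw [fibreDivisor, map_sum]
  simp only [Divisor.degree_single, one_mul]
  rw [Finset.sum_congr rfl fun Q _ => show ((Q.degree : ℕ) : ℤ) = 1 by
    rw [show Q.degree = 1 from PlaceOver.isRational_of_isAlgClosed Q]; rfl]
  simp

/-- The deck group fixes every fibre divisor. [folklore] -/
theorem deck_smul_fibreDivisor (ζ : CyclicCoverDeck L p) (P : PlaceOver L (RatFunc L)) :
    ζ • fibreDivisor K L p f P = fibreDivisor K L p f P := by
  ext Q
  rw [smul_divisor_apply, fibreDivisor_apply, fibreDivisor_apply, restrict_deck_smul]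

section Main

variable [IsAlgClosed L] [hp : Fact p.Prime]

omit [IsAlgClosed L] in
/-- The fibre divisor of a root place is `T_α`. [folklore] -/
theorem fibreDivisor_placeXSubC_of_isRoot (hsep : f.Separable) {α : L} (hα : (f.map (algebraMap K L)).IsRoot α) :
    fibreDivisor K L p f (placeXSubC α) = Finsupp.single (rootPlace K L p f α) 1 := by
  ext Q
  rw [fibreDivisor_apply, Finsupp.single_apply]
  by_cases h : Q.restrict (K := L) (F := RatFunc L) = placeXSubC α
  · rw [if_pos h, if_pos (eq_rootPlace_of_restrict_eq hsep hα h).symm]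
  · rw [if_neg h, if_neg]
    rintro rfl
    exact h (restrict_rootPlace α)

/-- `deg (fibreDivisor P) = p` for `P = P_∞` (`p ∣ deg f`). [cite: Stichtenoth2009, Prop. 3.7.3] -/
theorem degree_fibreDivisor_inftyPlace {ζ₀ : L} (hζ₀ : IsPrimitiveRoot ζ₀ p) (hdvd : p ∣ f.natDegree)
    (hf : f ≠ 0) : (fibreDivisor K L p f (ratFuncInftyPlace L)).degree = p := by
  rw [degree_fibreDivisor_eq_card, card_fibre_inftyPlace hζ₀ hdvd hf]

/-- `deg (fibreDivisor P_β) = p` for a non-root `β`. [cite: Stichtenoth2009, Prop. 3.7.3] -/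
theorem degree_fibreDivisor_of_eval_ne_zero {ζ₀ : L} (hζ₀ : IsPrimitiveRoot ζ₀ p) {β : L}
    (hβ : (f.map (algebraMap K L)).eval β ≠ 0) : (fibreDivisor K L p f (placeXSubC β)).degree = p := by
  rw [degree_fibreDivisor_eq_card, card_fibre_of_eval_ne_zero hζ₀ hβ]

/-! ### The principal divisors of `x - a` and `y` -/

omit [IsAlgClosed L] hp in
/-- Coefficient of `(x - a)` at a place above `∞`: `-e(Q|∞)`. [folklore] -/
theorem ord_genX_sub_of_restrict_eq_inftyPlace {Q : PlaceOver L (SuperellipticFunctionField K L p f)}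
    (hQ : Q.restrict (K := L) (F := RatFunc L) = ratFuncInftyPlace L) (a : L) :
    Q.ord (genX K L p f - algebraMap L _ a) = -ramificationIdx K L p f Q := by
  rw [ord_genX_sub_algebraMap, hQ, ord_ratFuncInftyPlace_X_sub_C, mul_neg, mul_one]

/-- **`(x - α) = p T_α - fibreDivisor ∞`** for a root `α` (`v_{T_α}(x - α) = p`; above `∞` the
cover is unramified and `x - α` has simple poles). [cite: Schaefer1998, §3] -/
theorem principalDivisor_genX_sub_of_isRoot {ζ₀ : L} (hζ₀ : IsPrimitiveRoot ζ₀ p) (hsep : f.Separable)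
    (hdvd : p ∣ f.natDegree) {α : L} (hα : (f.map (algebraMap K L)).IsRoot α) :
    principalDivisor L (genX K L p f - algebraMap L _ α) =
      (p : ℤ) • Finsupp.single (rootPlace K L p f α) 1 - fibreDivisor K L p f (ratFuncInftyPlace L) := by
  ext Q
  rw [principalDivisor_apply_of_ne_zero (genX_sub_algebraMap_ne_zero K L p f α), Finsupp.sub_apply,
    Finsupp.smul_apply, fibreDivisor_apply, Finsupp.single_apply, smul_eq_mul]
  rcases eq_ratFuncInftyPlace_or_exists_eq_placeXSubC L (Q.restrict (K := L) (F := RatFunc L)) with h | ⟨b, hb⟩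
  · rw [ord_genX_sub_of_restrict_eq_inftyPlace h, ramificationIdx_eq_one_of_restrict_eq_inftyPlace hζ₀ hdvd
      hsep.ne_zero h, if_pos h, if_neg]
    · simp
    · rintro rfl
      exact placeXSubC_ne_ratFuncInftyPlace α ((restrict_rootPlace (K := K) (p := p) (f := f) α).symm.trans h)
  · rw [if_neg (fun h' => placeXSubC_ne_ratFuncInftyPlace b (hb.symm.trans h'))]
    by_cases hba : b = α
    · subst hba
      rw [eq_rootPlace_of_restrict_eq hsep hα hb, if_pos rfl, ord_rootPlace_genX_sub hsep hα]; simp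
    · rw [ord_genX_sub_eq_zero_of_restrict_eq hb hba, if_neg]
      · simp
      · rintro rfl
        exact hba (placeXSubC_injective (hb.symm.trans (restrict_rootPlace α)))

/-- **`(x - β) = fibreDivisor P_β - fibreDivisor ∞`** for a non-root `β` (the cover is unramified
above `β` and above `∞`). [cite: Schaefer1998, §3] -/
theorem principalDivisor_genX_sub_of_eval_ne_zero {ζ₀ : L} (hζ₀ : IsPrimitiveRoot ζ₀ p) (hsep : f.Separable)
    (hdvd : p ∣ f.natDegree) {β : L} (hβ : (f.map (algebraMap K L)).eval β ≠ 0) :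
    principalDivisor L (genX K L p f - algebraMap L _ β) =
      fibreDivisor K L p f (placeXSubC β) - fibreDivisor K L p f (ratFuncInftyPlace L) := by
  ext Q
  rw [principalDivisor_apply_of_ne_zero (genX_sub_algebraMap_ne_zero K L p f β), Finsupp.sub_apply,
    fibreDivisor_apply, fibreDivisor_apply]
  rcases eq_ratFuncInftyPlace_or_exists_eq_placeXSubC L (Q.restrict (K := L) (F := RatFunc L)) with h | ⟨b, hb⟩
  · rw [ord_genX_sub_of_restrict_eq_inftyPlace h, ramificationIdx_eq_one_of_restrict_eq_inftyPlace hζ₀ hdvd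
      hsep.ne_zero h, if_pos h, if_neg (fun h' => placeXSubC_ne_ratFuncInftyPlace β (h'.symm.trans h))]
    simp
  · rw [if_neg (fun h' => placeXSubC_ne_ratFuncInftyPlace b (hb.symm.trans h'))]
    by_cases hbβ : b = β
    · subst hbβ
      rw [if_pos hb, ord_genX_sub_algebraMap, hb, ord_placeXSubC_X_sub_C, mul_one,
        ramificationIdx_eq_one_of_eval_ne_zero hζ₀ hβ hb]; simp
    · rw [ord_genX_sub_eq_zero_of_restrict_eq hb hbβ, if_neg (fun h' => hbβ (placeXSubC_injective (hb.symm.trans h')))]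
      simp

omit [IsAlgClosed L] hp in
/-- The sum `∑_α T_α` over the root set, evaluated at a place: `1` at the `T_α`, `0` elsewhere.
[folklore] -/
theorem sum_single_rootPlace_apply (hf : f ≠ 0) (Q : PlaceOver L (SuperellipticFunctionField K L p f)) :
    (∑ α : f.rootSet L, Finsupp.single (rootPlace K L p f (α : L)) (1 : ℤ)) Q =
      if ∃ α : L, (f.map (algebraMap K L)).IsRoot α ∧ Q = rootPlace K L p f α then 1 else 0 := by
  rw [Finsupp.finsetSum_apply]
  simp only [Finsupp.single_apply]
  split_ifs with h
  · obtain ⟨α, hα, rfl⟩ := h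
    rw [Finset.sum_eq_single ⟨α, mem_rootSet_of_isRoot hf hα⟩]
    · simp
    · intro b _ hb
      rw [if_neg]
      intro h'
      exact hb (Subtype.ext (rootPlace_injective h'))
    · intro h'; exact absurd (Finset.mem_univ _) h'
  · refine Finset.sum_eq_zero fun α _ => if_neg fun h' => h ⟨α, isRoot_of_mem_rootSet α.2, h'.symm⟩

/-- **`(y) = ∑_α T_α - k · fibreDivisor ∞`** (`deg f = pk`): `y` has simple zeros at the
ramification points and poles of order `k` above `∞`. [cite: Schaefer1998, §3] -/
theorem principalDivisor_genY {ζ₀ : L} (hζ₀ : IsPrimitiveRoot ζ₀ p) (hsep : f.Separable) {k : ℕ}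
    (hdeg : f.natDegree = p * k) :
    principalDivisor L (genY K L p f) =
      (∑ α : f.rootSet L, Finsupp.single (rootPlace K L p f (α : L)) 1) -
        (k : ℤ) • fibreDivisor K L p f (ratFuncInftyPlace L) := by
  have hf : f ≠ 0 := hsep.ne_zero
  have hfL : f.map (algebraMap K L) ≠ 0 := (Polynomial.map_ne_zero_iff (algebraMap K L).injective).2 hf
  have hp0 : (p : ℤ) ≠ 0 := by exact_mod_cast hp.out.ne_zero
  ext Q
  rw [principalDivisor_apply_of_ne_zero (genY_ne_zero hp.out.ne_zero hf), Finsupp.sub_apply,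
    Finsupp.smul_apply, fibreDivisor_apply, sum_single_rootPlace_apply hf, smul_eq_mul]
  have hy := natCast_mul_ord_genY hp.out.ne_zero hf Q
  rcases eq_ratFuncInftyPlace_or_exists_eq_placeXSubC L (Q.restrict (K := L) (F := RatFunc L)) with h | ⟨b, hb⟩
  · -- above `∞`: `p v(y) = 1 · (-pk)`
    rw [h, ord_ratFuncInftyPlace_algebraMap L hfL, natDegree_map, hdeg,
      ramificationIdx_eq_one_of_restrict_eq_inftyPlace hζ₀ ⟨k, hdeg⟩ hf h] at hy
    have hord : Q.ord (genY K L p f) = -k := by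
      push_cast at hy
      have : (p : ℤ) * Q.ord (genY K L p f) = p * (-k) := by rw [hy]; ring
      exact mul_left_cancel₀ hp0 this
    rw [hord, if_neg, if_pos h]
    · simp
    · rintro ⟨α, -, rfl⟩
      exact placeXSubC_ne_ratFuncInftyPlace α ((restrict_rootPlace (K := K) (p := p) (f := f) α).symm.trans h)
  · rw [if_neg (fun h' => placeXSubC_ne_ratFuncInftyPlace b (hb.symm.trans h')), mul_zero, sub_zero]
    by_cases hbr : (f.map (algebraMap K L)).IsRoot b
    · rw [eq_rootPlace_of_restrict_eq hsep hbr hb, ord_rootPlace_genY hsep hbr, if_pos ⟨b, hbr, rfl⟩]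
    · -- above a non-root: `p v(y) = e · 0`
      rw [hb, ord_placeXSubC_algebraMap_of_eval_ne_zero b hbr, mul_zero] at hy
      rw [(mul_eq_zero.1 hy).resolve_left hp0, if_neg]
      rintro ⟨α, hα, rfl⟩
      rw [restrict_rootPlace] at hb
      exact hbr ((placeXSubC_injective hb) ▸ hα)

/-! ### Consequences in the divisor class group -/

omit [IsAlgClosed L] hp in
/-- Principal divisors of nonzero functions lie in `Princ`. [folklore] -/
theorem principalDivisor_mem {z : SuperellipticFunctionField K L p f} (hz : z ≠ 0) :
    principalDivisor L z ∈ principalDivisors L (SuperellipticFunctionField K L p f) :=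
  AddSubgroup.subset_closure ⟨z, hz, rfl⟩

/-- **`p (T_α - T_β) ∼ 0`** for roots `α, β` (`= (x - α) - (x - β)`). [cite: Schaefer1998, Prop. 3.2] -/
theorem smul_single_sub_single_mem {ζ₀ : L} (hζ₀ : IsPrimitiveRoot ζ₀ p) (hsep : f.Separable)
    (hdvd : p ∣ f.natDegree) {α β : L} (hα : (f.map (algebraMap K L)).IsRoot α)
    (hβ : (f.map (algebraMap K L)).IsRoot β) :
    (p : ℤ) • (Finsupp.single (rootPlace K L p f α) (1 : ℤ) - Finsupp.single (rootPlace K L p f β) 1) ∈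
      principalDivisors L (SuperellipticFunctionField K L p f) := by
  have h : (p : ℤ) • (Finsupp.single (rootPlace K L p f α) (1 : ℤ) - Finsupp.single (rootPlace K L p f β) 1) =
      principalDivisor L (genX K L p f - algebraMap L _ α) - principalDivisor L (genX K L p f - algebraMap L _ β) := by
    rw [principalDivisor_genX_sub_of_isRoot hζ₀ hsep hdvd hα, principalDivisor_genX_sub_of_isRoot hζ₀ hsep hdvd hβ,
      smul_sub]
    abel
  rw [h]
  exact sub_mem (principalDivisor_mem (genX_sub_algebraMap_ne_zero K L p f α))
    (principalDivisor_mem (genX_sub_algebraMap_ne_zero K L p f β))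

/-- **`fibreDivisor ∞ ∼ p T_α`** for a root `α`. [cite: Schaefer1998, §3] -/
theorem fibreDivisor_inftyPlace_sub_mem {ζ₀ : L} (hζ₀ : IsPrimitiveRoot ζ₀ p) (hsep : f.Separable)
    (hdvd : p ∣ f.natDegree) {α : L} (hα : (f.map (algebraMap K L)).IsRoot α) :
    fibreDivisor K L p f (ratFuncInftyPlace L) - (p : ℤ) • Finsupp.single (rootPlace K L p f α) 1 ∈
      principalDivisors L (SuperellipticFunctionField K L p f) := by
  have h : fibreDivisor K L p f (ratFuncInftyPlace L) - (p : ℤ) • Finsupp.single (rootPlace K L p f α) 1 =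
      -principalDivisor L (genX K L p f - algebraMap L _ α) := by
    rw [principalDivisor_genX_sub_of_isRoot hζ₀ hsep hdvd hα]; abel
  rw [h]
  exact neg_mem (principalDivisor_mem (genX_sub_algebraMap_ne_zero K L p f α))

/-- **`fibreDivisor P ∼ p T_α`** for every place `P` of `L(x)` not below a ramification place
(`P = ∞` or `P = P_β`, `f(β) ≠ 0`) and every root `α`: all fibres of `C_f → ℙ¹` are linearly
equivalent. [cite: Schaefer1998, §3] -/
theorem fibreDivisor_sub_mem {ζ₀ : L} (hζ₀ : IsPrimitiveRoot ζ₀ p) (hsep : f.Separable)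
    (hdvd : p ∣ f.natDegree) {α : L} (hα : (f.map (algebraMap K L)).IsRoot α) {P : PlaceOver L (RatFunc L)}
    (hP : ∀ β : L, P = placeXSubC β → (f.map (algebraMap K L)).eval β ≠ 0) :
    fibreDivisor K L p f P - (p : ℤ) • Finsupp.single (rootPlace K L p f α) 1 ∈
      principalDivisors L (SuperellipticFunctionField K L p f) := by
  rcases eq_ratFuncInftyPlace_or_exists_eq_placeXSubC L P with rfl | ⟨β, rfl⟩
  · exact fibreDivisor_inftyPlace_sub_mem hζ₀ hsep hdvd hα
  · have hβ := hP β rfl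
    have h : fibreDivisor K L p f (placeXSubC β) - (p : ℤ) • Finsupp.single (rootPlace K L p f α) 1 =
        principalDivisor L (genX K L p f - algebraMap L _ β) +
          (fibreDivisor K L p f (ratFuncInftyPlace L) - (p : ℤ) • Finsupp.single (rootPlace K L p f α) 1) := by
      rw [principalDivisor_genX_sub_of_eval_ne_zero hζ₀ hsep hdvd hβ]; abel
    rw [h]
    exact add_mem (principalDivisor_mem (genX_sub_algebraMap_ne_zero K L p f β))
      (fibreDivisor_inftyPlace_sub_mem hζ₀ hsep hdvd hα)

/-- The degree of the fibre divisor of a place not below a ramification place is `p`. [folklore] -/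
theorem degree_fibreDivisor {ζ₀ : L} (hζ₀ : IsPrimitiveRoot ζ₀ p) (hsep : f.Separable)
    (hdvd : p ∣ f.natDegree) {P : PlaceOver L (RatFunc L)}
    (hP : ∀ β : L, P = placeXSubC β → (f.map (algebraMap K L)).eval β ≠ 0) :
    (fibreDivisor K L p f P).degree = p := by
  rcases eq_ratFuncInftyPlace_or_exists_eq_placeXSubC L P with rfl | ⟨β, rfl⟩
  · exact degree_fibreDivisor_inftyPlace hζ₀ hdvd hsep.ne_zero
  · exact degree_fibreDivisor_of_eval_ne_zero hζ₀ (hP β rfl)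

/-- `#(root set) = deg f` over the algebraically closed `L` (`f` separable). [folklore] -/
theorem card_rootSet (hsep : f.Separable) : Fintype.card (f.rootSet L) = f.natDegree :=
  card_rootSet_eq_natDegree hsep (IsAlgClosed.splits _)

/-- **`∑_α (T_α - T_{α₀}) ∼ 0`** (`= (y) - k (x - α₀)`, `deg f = pk`): the relation making the map
from the heart well defined. [cite: Schaefer1998, Prop. 3.2] -/
theorem sum_single_sub_single_mem {ζ₀ : L} (hζ₀ : IsPrimitiveRoot ζ₀ p) (hsep : f.Separable) {k : ℕ}
    (hdeg : f.natDegree = p * k) {α₀ : L} (hα₀ : (f.map (algebraMap K L)).IsRoot α₀) :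
    ∑ α : f.rootSet L, (Finsupp.single (rootPlace K L p f (α : L)) (1 : ℤ) - Finsupp.single (rootPlace K L p f α₀) 1) ∈
      principalDivisors L (SuperellipticFunctionField K L p f) := by
  have hn : Fintype.card (f.rootSet L) = p * k := (card_rootSet hsep).trans hdeg
  have h : ∑ α : f.rootSet L, (Finsupp.single (rootPlace K L p f (α : L)) (1 : ℤ) -
      Finsupp.single (rootPlace K L p f α₀) 1) =
      principalDivisor L (genY K L p f) - (k : ℤ) • principalDivisor L (genX K L p f - algebraMap L _ α₀) := by
    rw [Finset.sum_sub_distrib, Finset.sum_const, Finset.card_univ, hn, principalDivisor_genY hζ₀ hsep hdeg,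
      principalDivisor_genX_sub_of_isRoot hζ₀ hsep ⟨k, hdeg⟩ hα₀, smul_sub, smul_smul, ← natCast_zsmul,
      Nat.cast_mul]
    module
  rw [h]
  exact sub_mem (principalDivisor_mem (genY_ne_zero hp.out.ne_zero hsep.ne_zero))
    (zsmul_mem (principalDivisor_mem (genX_sub_algebraMap_ne_zero K L p f α₀)) _)

/-! ### Divisors invariant under the deck group -/

/-- **A deck-invariant divisor is constant along the unramified fibres** (they are single orbits of
the deck group, `SuperellipticFibres`). [cite: Schaefer1998, §3] -/
theorem apply_eq_apply_of_invariant {ζ₀ : L} (hζ₀ : IsPrimitiveRoot ζ₀ p) (hsep : f.Separable)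
    (hdvd : p ∣ f.natDegree) {D : Divisor L (SuperellipticFunctionField K L p f)}
    (hD : ∀ ζ : CyclicCoverDeck L p, ζ • D = D) {Q Q' : PlaceOver L (SuperellipticFunctionField K L p f)}
    (hQQ' : Q.restrict (K := L) (F := RatFunc L) = Q'.restrict (K := L) (F := RatFunc L))
    (hnr : ∀ β : L, Q.restrict (K := L) (F := RatFunc L) = placeXSubC β → (f.map (algebraMap K L)).eval β ≠ 0) :
    D Q = D Q' := by
  obtain ⟨ζ, hζ⟩ : ∃ ζ : CyclicCoverDeck L p, ζ • Q = Q' := by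
    rcases eq_ratFuncInftyPlace_or_exists_eq_placeXSubC L (Q.restrict (K := L) (F := RatFunc L)) with h | ⟨β, hβ⟩
    · exact exists_deck_smul_eq_of_restrict_eq_inftyPlace hζ₀ hdvd hsep.ne_zero h (hQQ' ▸ h)
    · exact exists_deck_smul_eq_of_eval_ne_zero hζ₀ (hnr β hβ) hβ (hQQ' ▸ hβ)
  calc D Q = D (ζ⁻¹ • Q') := by rw [← hζ, inv_smul_smul]
    _ = (ζ • D) Q' := (smul_divisor_apply ζ D Q').symm
    _ = D Q' := by rw [hD]

/-- **Deck-invariant divisors modulo principal divisors.** For a divisor `D` of `L(C_f)/L` fixed by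
the deck group and a root `α₀` of `f`,
`D ∼ ∑_α D(T_α) (T_α - T_{α₀}) + (deg D) T_{α₀}` and `deg D ≡ ∑_α D(T_α) (mod p)`:
off the ramification places `D` is constant along the fibres, hence a combination of fibre
divisors, each of degree `p` and `∼ p T_{α₀}` (Schaefer, Math. Ann. 310, proof of Prop. 3.4;
Poonen–Schaefer §6).
[cite: Schaefer1998, Prop. 3.4] -/
theorem sub_sum_smul_sub_degree_smul_mem_of_invariant {ζ₀ : L} (hζ₀ : IsPrimitiveRoot ζ₀ p)
    (hsep : f.Separable) (hdvd : p ∣ f.natDegree) (α₀ : f.rootSet L)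
    {D : Divisor L (SuperellipticFunctionField K L p f)} (hD : ∀ ζ : CyclicCoverDeck L p, ζ • D = D) :
    (D - (∑ α : f.rootSet L, D (rootPlace K L p f (α : L)) •
          (Finsupp.single (rootPlace K L p f (α : L)) (1 : ℤ) - Finsupp.single (rootPlace K L p f (α₀ : L)) 1)) -
        D.degree • Finsupp.single (rootPlace K L p f (α₀ : L)) 1 ∈
      principalDivisors L (SuperellipticFunctionField K L p f)) ∧
    (p : ℤ) ∣ D.degree - ∑ α : f.rootSet L, D (rootPlace K L p f (α : L)) := by
  have hf : f ≠ 0 := hsep.ne_zero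
  have hα₀ := isRoot_of_mem_rootSet (K := K) (L := L) α₀.2
  set T : L → PlaceOver L (SuperellipticFunctionField K L p f) := rootPlace K L p f with hT
  set s₀ : Divisor L (SuperellipticFunctionField K L p f) := Finsupp.single (T α₀) 1 with hs₀
  -- `B = ∑_α D(T_α) T_α`, `E = D - B`
  set B : Divisor L (SuperellipticFunctionField K L p f) :=
    ∑ α : f.rootSet L, D (T α) • Finsupp.single (T α) (1 : ℤ) with hB
  set E : Divisor L (SuperellipticFunctionField K L p f) := D - B with hE
  have hE_apply : ∀ Q, E Q = if ∃ α : L, (f.map (algebraMap K L)).IsRoot α ∧ Q = T α then 0 else D Q := by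
    intro Q
    rw [hE, Finsupp.sub_apply, hB, Finsupp.finsetSum_apply]
    simp only [Finsupp.smul_apply, Finsupp.single_apply, smul_eq_mul, mul_ite, mul_one, mul_zero]
    split_ifs with h
    · obtain ⟨α, hα, rfl⟩ := h
      rw [Finset.sum_eq_single ⟨α, mem_rootSet_of_isRoot hf hα⟩]
      · simp
      · intro b _ hb
        rw [if_neg]
        intro h'
        exact hb (Subtype.ext (rootPlace_injective h'))
      · intro h'; exact absurd (Finset.mem_univ _) h'
    · rw [Finset.sum_eq_zero (fun (α : f.rootSet L) _ =>
        if_neg (fun h' => h ⟨(α : L), isRoot_of_mem_rootSet α.2, h'.symm⟩)), sub_zero]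
  -- a place above each place of `L(x)`
  let pick : PlaceOver L (RatFunc L) → PlaceOver L (SuperellipticFunctionField K L p f) := fun P =>
    Classical.choose (PlaceOver.exists_restrict_eq' (K := L) (F := RatFunc L)
      (F' := SuperellipticFunctionField K L p f) P)
  have hpick : ∀ P, (pick P).restrict (K := L) (F := RatFunc L) = P := fun P =>
    Classical.choose_spec (PlaceOver.exists_restrict_eq' (K := L) (F := RatFunc L)
      (F' := SuperellipticFunctionField K L p f) P)
  set R := E.support.image (fun Q => Q.restrict (K := L) (F := RatFunc L)) with hR
  -- the places in `R` are not below ramification places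
  have hRnr : ∀ P ∈ R, ∀ β : L, P = placeXSubC β → (f.map (algebraMap K L)).eval β ≠ 0 := by
    intro P hP β hPβ hβ0
    obtain ⟨Q, hQ, rfl⟩ := Finset.mem_image.1 hP
    have hQT : Q = T β := eq_rootPlace_of_restrict_eq hsep hβ0 hPβ
    rw [Finsupp.mem_support_iff, hE_apply, if_pos ⟨β, hβ0, hQT⟩] at hQ
    exact hQ rfl
  have hnot : ∀ P ∈ R, ∀ Q' : PlaceOver L (SuperellipticFunctionField K L p f),
      Q'.restrict (K := L) (F := RatFunc L) = P → ¬ ∃ α : L, (f.map (algebraMap K L)).IsRoot α ∧ Q' = T α := by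
    rintro P hP Q' hQ' ⟨α, hα, rfl⟩
    refine hRnr P hP α ?_ hα
    rw [← hQ']
    exact restrict_rootPlace (K := K) (L := L) (p := p) (f := f) α
  -- `E = ∑_{P ∈ R} D(pick P) · fibreDivisor P`
  have hEsum : E = ∑ P ∈ R, D (pick P) • fibreDivisor K L p f P := by
    ext Q
    rw [Finsupp.finsetSum_apply]
    simp only [Finsupp.smul_apply, fibreDivisor_apply, smul_eq_mul, mul_ite, mul_one, mul_zero]
    rw [Finset.sum_ite_eq]
    by_cases hQR : Q.restrict (K := L) (F := RatFunc L) ∈ R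
    · rw [if_pos hQR, hE_apply Q, if_neg (hnot _ hQR Q rfl)]
      have h1 := apply_eq_apply_of_invariant hζ₀ hsep hdvd hD (hpick (Q.restrict (K := L) (F := RatFunc L))).symm
        (fun β hβ => hRnr _ hQR β hβ)
      exact h1
    · rw [if_neg hQR]
      by_contra hne
      exact hQR (Finset.mem_image.2 ⟨Q, Finsupp.mem_support_iff.2 hne, rfl⟩)
  -- degrees
  have hdegE : E.degree = (p : ℤ) * ∑ P ∈ R, D (pick P) := by
    rw [hEsum, map_sum, Finset.mul_sum]
    refine Finset.sum_congr rfl fun P hP => ?_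
    rw [map_zsmul, smul_eq_mul, degree_fibreDivisor hζ₀ hsep hdvd (hRnr P hP), mul_comm]
  have hdegB : B.degree = ∑ α : f.rootSet L, D (T α) := by
    rw [hB, map_sum]
    refine Finset.sum_congr rfl fun α _ => ?_
    rw [map_zsmul, Divisor.degree_single, degree_rootPlace hsep (isRoot_of_mem_rootSet α.2), smul_eq_mul]
    simp
  have hdegD : D.degree = (p : ℤ) * (∑ P ∈ R, D (pick P)) + ∑ α : f.rootSet L, D (T α) := by
    rw [← hdegE, ← hdegB, hE, map_sub, sub_add_cancel]
  -- the principal divisor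
  have hmem : ∑ P ∈ R, D (pick P) • (fibreDivisor K L p f P - (p : ℤ) • s₀) ∈
      principalDivisors L (SuperellipticFunctionField K L p f) :=
    AddSubgroup.sum_mem _ fun P hP => AddSubgroup.zsmul_mem _ (fibreDivisor_sub_mem hζ₀ hsep hdvd hα₀ (hRnr P hP)) _
  have key : D - (∑ α : f.rootSet L, D (T α) • (Finsupp.single (T α) (1 : ℤ) - s₀)) - D.degree • s₀ =
      ∑ P ∈ R, D (pick P) • (fibreDivisor K L p f P - (p : ℤ) • s₀) := by
    have h1 : ∑ α : f.rootSet L, D (T α) • (Finsupp.single (T α) (1 : ℤ) - s₀) =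
        B - (∑ α : f.rootSet L, D (T α)) • s₀ := by
      rw [hB, Finset.sum_smul, ← Finset.sum_sub_distrib]
      exact Finset.sum_congr rfl fun α _ => smul_sub _ _ _
    have h2 : ∑ P ∈ R, D (pick P) • (fibreDivisor K L p f P - (p : ℤ) • s₀) =
        E - ((∑ P ∈ R, D (pick P)) * p) • s₀ := by
      rw [hEsum, Finset.sum_mul, Finset.sum_smul, ← Finset.sum_sub_distrib]
      exact Finset.sum_congr rfl fun P _ => by rw [smul_sub, smul_smul]
    rw [h1, h2, hdegD, hE]
    module
  refine ⟨by rw [key]; exact hmem, ⟨∑ P ∈ R, D (pick P), ?_⟩⟩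
  rw [hdegD]
  ring

end Main

end SuperellipticFunctionField

end Literature.NumberTheory.GaloisRepresentations

/-!
## Part 4. Proof of `superelliptic_lambdaTorsion_iso_heart`: `J(C_f)[1 - ζ]` is the heart of the
# permutation module on the roots of `f` (Poonen–Schaefer 1997, Schaefer 1998, Zarhin 2018 Thm. 9.1)

Final file of the proof of the named fact `superelliptic_lambdaTorsion_iso_heart` of
`SuperellipticTorsionRep`.  With `L` algebraically closed containing a primitive `p`-th root of unity
`ζ₀`, `f ∈ K[X]` separable with `p ∣ deg f`, `Ω = f.rootSet L`, `T_α = rootPlace α`, a base root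
`α₀ ∈ Ω` and `Pic = SuperellipticPic K L p f = Cl(L(C_f)/L)`:

* `SuperellipticFunctionField.psi` — the map `Ψ : Heart p Ω →+ Pic`: on `a ∈ (𝔽_p^Ω)⁰`,
  `Ψ a = [∑_α ã_α (T_α - T_{α₀})]` (`ã_α ∈ [0, p)` lifting `a_α`; well defined on `𝔽_p`-vectors since
  `p (T_α - T_{α₀}) ∼ 0`, and killing `1_Ω` since `∑_α (T_α - T_{α₀}) ∼ 0`; independent of `α₀` on
  sum-zero vectors) — built `𝔽_p`-linearly into `Pic[p]` with `Finsupp.linearCombination` and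
  `Submodule.liftQ` (`psi_mk`);
* `psi_mem_lambdaTorsion` — its values have degree `0` and are fixed by the deck group;
* `psi_heartRep` — **`Gal`-equivariance**, from `σ T_α = T_{σ α}` (`smul_rootPlace`);
* `psi_injective` — **injectivity** (Schaefer Prop. 3.2 / Poonen–Schaefer Prop. 6.1): if
  `∑ ã_α (T_α - T_{α₀}) = (h)` then `(ζ h) = (h)`, so `ζ h = c h`, and expanding `h` in the basis
  `1, y, …, y^{p-1}` of `L(C_f)/L(x)` gives `h = r(x) y^j`, whence `ã_α ≡ v_{T_α}(h) ≡ j (mod p)` for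
  all `α`, i.e. `a ∈ 𝔽_p · 1_Ω`;
* `exists_psi_eq` — **surjectivity onto `J[1 - ζ]`** (Schaefer Prop. 3.4): a degree-zero class `[D]`
  fixed by `ζ₀` has `ζ₀ D - D = (h)` with `N(h) ∈ L^× = (L^×)^p`, so by **Hilbert's Theorem 90** for the
  cyclic group `⟨ζ₀⟩` acting on `L(C_f)` (`hilbert90`, proved here from Dedekind's independence of
  characters, Mathlib `linearIndependent_monoidHom`) `[D] = [D']` with `D'` deck-invariant, and
  deck-invariant divisors of degree `0` are `∼ ∑_α D'(T_α)(T_α - T_{α₀})`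
  (`sub_sum_smul_sub_degree_smul_mem_of_invariant`);
* `superelliptic_lambdaTorsion_iso_heart_holds` — the discharge, for `L = K̄`, `G = Gal(K̄/K)`.

## References

* B. Poonen, E. F. Schaefer, *Explicit descent for Jacobians of cyclic covers of the projective
  line*, J. reine angew. Math. 488 (1997) 141–188, §§5–6. [PoonenSchaefer1997]
* E. F. Schaefer, *Computing a Selmer group of a Jacobian using functions on the curve*,
  Math. Ann. 310 (1998) 447–471, §3, Prop. 3.2–3.4. [Schaefer1998]
* Yu. G. Zarhin, *Endomorphism algebras of abelian varieties with special reference to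
  superelliptic Jacobians*, arXiv:1706.00110, Thm. 9.1. [Zarhin2018SuperellipticJacobians]
-/

noncomputable section

open Polynomial
open scoped Classical

namespace Literature.NumberTheory.GaloisRepresentations

open Literature.NumberTheory.DiophantineGeometry Literature.NumberTheory.DiophantineGeometry.AlgFunctionField

universe u v w

attribute [local instance] Finsupp.comapSMul Finsupp.comapMulAction Finsupp.comapDistribMulAction
attribute [local instance] AddSubgroup.torsionBy.zmodModule

/-! ### The deck group: powers and injectivity of `val` -/

namespace CyclicCoverDeck

variable {L : Type v} [Field L] {m : ℕ}

/-- `val` is injective. [folklore] -/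
theorem val_injective : Function.Injective (CyclicCoverDeck.val : CyclicCoverDeck L m → L) :=
  fun _ _ h => CyclicCoverDeck.equivRootsOfUnity.injective (Subtype.ext (Units.ext h))

/-- `val (ζ^n) = (val ζ)^n`. [folklore] -/
theorem val_pow_eq_pow_val (ζ : CyclicCoverDeck L m) (n : ℕ) : (ζ ^ n).val = ζ.val ^ n := by
  induction n with
  | zero => rw [pow_zero, pow_zero, CyclicCoverDeck.val_one]
  | succ n ih => rw [pow_succ, pow_succ, CyclicCoverDeck.val_mul, ih]

variable [NeZero m]

/-- The deck transformation attached to a root of unity `ζ₀`. [folklore] -/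
def ofRoot {ζ₀ : L} (h : ζ₀ ^ m = 1) : CyclicCoverDeck L m :=
  CyclicCoverDeck.equivRootsOfUnity.symm (rootsOfUnity.mkOfPowEq ζ₀ h)

/-- `val (ofRoot ζ₀) = ζ₀`. [folklore] -/
theorem val_ofRoot {ζ₀ : L} (h : ζ₀ ^ m = 1) : (ofRoot h).val = ζ₀ := by
  show (((CyclicCoverDeck.equivRootsOfUnity
    (CyclicCoverDeck.equivRootsOfUnity.symm (rootsOfUnity.mkOfPowEq ζ₀ h)) : Lˣ) : L)) = ζ₀
  rw [MulEquiv.apply_symm_apply, rootsOfUnity.val_mkOfPowEq_coe]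

/-- Every deck transformation is a power of the one attached to a primitive root. [folklore] -/
theorem exists_eq_ofRoot_pow {ζ₀ : L} (hζ₀ : IsPrimitiveRoot ζ₀ m) (ζ : CyclicCoverDeck L m) :
    ∃ j, j < m ∧ ζ = ofRoot hζ₀.pow_eq_one ^ j := by
  obtain ⟨j, hj, hjζ⟩ := hζ₀.eq_pow_of_pow_eq_one (CyclicCoverDeck.val_pow ζ)
  exact ⟨j, hj, val_injective (by rw [val_pow_eq_pow_val, val_ofRoot, hjζ])⟩

/-- `(ofRoot ζ₀)^m = 1`. [folklore] -/
theorem ofRoot_pow_eq_one {ζ₀ : L} (h : ζ₀ ^ m = 1) : ofRoot h ^ m = 1 :=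
  val_injective (by rw [val_pow_eq_pow_val, val_ofRoot, h, CyclicCoverDeck.val_one])

end CyclicCoverDeck

namespace SuperellipticFunctionField

variable {K : Type u} [Field K] {L : Type v} [Field L] [Algebra K L] {p : ℕ} {f : K[X]}
variable [Fact (Irreducible (superellipticPoly K L p f))]

/-! ### The class map and invariance of divisors -/

variable (K L p f) in
/-- The class map `Div → Cl = Pic` as a homomorphism. [folklore] -/
def picMk : Divisor L (SuperellipticFunctionField K L p f) →+ SuperellipticPic K L p f where
  toFun D := SuperellipticPic.mk D
  map_zero' := rfl
  map_add' _ _ := rfl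

/-- `picMk D = [D]`. [folklore] -/
theorem picMk_apply (D : Divisor L (SuperellipticFunctionField K L p f)) :
    picMk K L p f D = SuperellipticPic.mk D := rfl

/-- `[D] = 0 ↔ D ∈ Princ`. [folklore] -/
theorem picMk_eq_zero_iff (D : Divisor L (SuperellipticFunctionField K L p f)) :
    picMk K L p f D = 0 ↔ D ∈ principalDivisors L (SuperellipticFunctionField K L p f) :=
  QuotientAddGroup.eq_zero_iff (N := principalDivisors L (SuperellipticFunctionField K L p f)) D

/-- `picMk` is surjective. [folklore] -/
theorem picMk_surjective : Function.Surjective (picMk K L p f) := SuperellipticPic.mk_surjective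

/-- `deg [D] = deg D`. [folklore] -/
theorem degree_picMk (D : Divisor L (SuperellipticFunctionField K L p f)) :
    SuperellipticPic.degree K L p f (picMk K L p f D) = D.degree := rfl

/-- `ζ • [D] = [ζ • D]` for the deck group. [folklore] -/
theorem deck_smul_picMk (ζ : CyclicCoverDeck L p) (D : Divisor L (SuperellipticFunctionField K L p f)) :
    ζ • picMk K L p f D = picMk K L p f (ζ • D) := rfl

/-- `σ • [D] = [σ • D]` for automorphisms of `L/K`. [folklore] -/
theorem smul_picMk {G : Type w} [Group G] [MulSemiringAction G L] [SMulCommClass G K L] (σ : G)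
    (D : Divisor L (SuperellipticFunctionField K L p f)) :
    σ • picMk K L p f D = picMk K L p f (σ • D) := rfl

/-- A divisor fixed by the deck transformation of a primitive root is fixed by the deck group.
[folklore] -/
theorem forall_deck_smul_eq_of_smul_eq [NeZero p] {ζ₀ : L} (hζ₀ : IsPrimitiveRoot ζ₀ p)
    {D : Divisor L (SuperellipticFunctionField K L p f)} (hD : CyclicCoverDeck.ofRoot hζ₀.pow_eq_one • D = D) :
    ∀ ζ : CyclicCoverDeck L p, ζ • D = D := by
  intro ζ
  obtain ⟨j, -, rfl⟩ := CyclicCoverDeck.exists_eq_ofRoot_pow hζ₀ ζ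
  induction j with
  | zero => rw [pow_zero, one_smul]
  | succ j ih => rw [pow_succ, mul_smul, hD, ih]

/-! ### The permutation module -/

omit [Fact (Irreducible (superellipticPoly K L p f))] in
/-- `(σ · a)(β) = a(σ⁻¹ β)` for the permutation representation. [folklore] -/
theorem permRep_apply {G : Type w} [Group G] [MulAction G (f.rootSet L)] (σ : G)
    (x : f.rootSet L →₀ ZMod p) (β : f.rootSet L) :
    permRep (ZMod p) G (f.rootSet L) σ x β = x (σ⁻¹ • β) := by
  conv_lhs => rw [← smul_inv_smul σ β]
  exact Finsupp.mapDomain_apply (MulAction.injective σ) x (σ⁻¹ • β)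

omit [Fact (Irreducible (superellipticPoly K L p f))] in
/-- For `a ∈ (𝔽_p^Ω)⁰`, `p ∣ ∑_α ã_α`. [folklore] -/
theorem dvd_sum_val [hp : Fact p.Prime] (x : augmentationSubmodule (ZMod p) (f.rootSet L)) :
    (p : ℤ) ∣ ∑ β : f.rootSet L, (((x : f.rootSet L →₀ ZMod p) β).val : ℤ) := by
  haveI : NeZero p := ⟨hp.out.ne_zero⟩
  have h := x.2
  rw [mem_augmentationSubmodule_iff, augmentation, Finsupp.linearCombination_apply,
    Finsupp.sum_fintype (x : f.rootSet L →₀ ZMod p) (fun _ a => a • (1 : ZMod p)) (fun _ => zero_smul _ _)] at h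
  simp only [smul_eq_mul, mul_one] at h
  have h2 : ((∑ β : f.rootSet L, ((x : f.rootSet L →₀ ZMod p) β).val : ℕ) : ZMod p) = 0 := by
    rw [Nat.cast_sum]
    simp only [ZMod.natCast_zmod_val]
    exact h
  rw [ZMod.natCast_eq_zero_iff] at h2
  exact_mod_cast Int.natCast_dvd_natCast.2 h2

/-! ### The generators `[T_α - T_{α₀}] ∈ Pic[p]` and the lift of an `𝔽_p`-vector -/

section Construction

variable [IsAlgClosed L] [hp : Fact p.Prime]

variable (K p f) in
/-- The divisor `T_α - T_{α₀}` for roots `α₀, α` (as elements of the root set). [cite: Schaefer1998, §3] -/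
def genDiv (α₀ α : f.rootSet L) : Divisor L (SuperellipticFunctionField K L p f) :=
  Finsupp.single (rootPlace K L p f (α : L)) 1 - Finsupp.single (rootPlace K L p f (α₀ : L)) 1

omit [IsAlgClosed L] hp in
/-- `genDiv α₀ α = genDiv β α - genDiv β α₀` (change of base root). [folklore] -/
theorem genDiv_eq_sub (α₀ α β : f.rootSet L) : genDiv K p f α₀ α = genDiv K p f β α - genDiv K p f β α₀ := by
  simp only [genDiv]; abel

omit [IsAlgClosed L] in
/-- `deg (T_α - T_{α₀}) = 0`. [folklore] -/
theorem degree_genDiv (hsep : f.Separable) (α₀ α : f.rootSet L) : (genDiv K p f α₀ α).degree = 0 := by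
  rw [genDiv, map_sub, Divisor.degree_single, Divisor.degree_single,
    degree_rootPlace hsep (isRoot_of_mem_rootSet α.2), degree_rootPlace hsep (isRoot_of_mem_rootSet α₀.2)]
  simp

omit [IsAlgClosed L] in
/-- The deck group fixes `T_α - T_{α₀}`. [folklore] -/
theorem deck_smul_genDiv (hsep : f.Separable) (ζ : CyclicCoverDeck L p) (α₀ α : f.rootSet L) :
    ζ • genDiv K p f α₀ α = genDiv K p f α₀ α := by
  rw [genDiv, smul_sub, Finsupp.comapSMul_single, Finsupp.comapSMul_single,
    deck_smul_rootPlace hsep (isRoot_of_mem_rootSet α.2), deck_smul_rootPlace hsep (isRoot_of_mem_rootSet α₀.2)]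

/-- `p [T_α - T_{α₀}] = 0` in `Pic`. [cite: Schaefer1998, Prop. 3.2] -/
theorem nsmul_picMk_genDiv {ζ₀ : L} (hζ₀ : IsPrimitiveRoot ζ₀ p) (hsep : f.Separable) (hdvd : p ∣ f.natDegree)
    (α₀ α : f.rootSet L) : p • picMk K L p f (genDiv K p f α₀ α) = 0 := by
  rw [← map_nsmul, picMk_eq_zero_iff, ← natCast_zsmul]
  exact smul_single_sub_single_mem hζ₀ hsep hdvd (isRoot_of_mem_rootSet α.2) (isRoot_of_mem_rootSet α₀.2)

/-- **The generator `[T_α - T_{α₀}] ∈ Pic[p] = J[p]`**. [cite: Schaefer1998, Prop. 3.2] -/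
def gen {ζ₀ : L} (hζ₀ : IsPrimitiveRoot ζ₀ p) (hsep : f.Separable) (hdvd : p ∣ f.natDegree)
    (α₀ α : f.rootSet L) : jacobianTorsion K L p f p :=
  ⟨picMk K L p f (genDiv K p f α₀ α), AddSubgroup.torsionBy.nsmul_iff.2 (nsmul_picMk_genDiv hζ₀ hsep hdvd α₀ α)⟩

/-- Underlying class of `gen`. [folklore] -/
@[simp] theorem coe_gen {ζ₀ : L} (hζ₀ : IsPrimitiveRoot ζ₀ p) (hsep : f.Separable) (hdvd : p ∣ f.natDegree)
    (α₀ α : f.rootSet L) :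
    ((gen hζ₀ hsep hdvd α₀ α : jacobianTorsion K L p f p) : SuperellipticPic K L p f) =
      picMk K L p f (genDiv K p f α₀ α) := rfl

omit [IsAlgClosed L] in
/-- The `ZMod p`-action on `Pic[p]` is by representatives: `(a • t : Pic) = a.val • t`. [folklore] -/
theorem coe_zmod_smul (a : ZMod p) (t : jacobianTorsion K L p f p) :
    ((a • t : jacobianTorsion K L p f p) : SuperellipticPic K L p f) = a.val • (t : SuperellipticPic K L p f) := by
  haveI : NeZero p := ⟨hp.out.ne_zero⟩
  conv_lhs => rw [← ZMod.natCast_zmod_val a]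
  rw [Nat.cast_smul_eq_nsmul, AddSubgroupClass.coe_nsmul]

variable (K p f) in
/-- The integral lift `∑_α ã_α (T_α - T_{α₀})`, `ã_α = val(a_α) ∈ [0, p)`, of `a ∈ 𝔽_p^Ω`.
[cite: Schaefer1998, §3] -/
def liftDiv (α₀ : f.rootSet L) (x : f.rootSet L →₀ ZMod p) : Divisor L (SuperellipticFunctionField K L p f) :=
  ∑ α : f.rootSet L, ((x α).val : ℤ) • genDiv K p f α₀ α

omit [IsAlgClosed L] in
/-- `deg (liftDiv x) = 0`. [folklore] -/
theorem degree_liftDiv (hsep : f.Separable) (α₀ : f.rootSet L) (x : f.rootSet L →₀ ZMod p) :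
    (liftDiv K p f α₀ x).degree = 0 := by
  rw [liftDiv, map_sum]
  exact Finset.sum_eq_zero fun α _ => by rw [map_zsmul, degree_genDiv hsep, smul_zero]

omit [IsAlgClosed L] in
/-- The deck group fixes `liftDiv x`. [folklore] -/
theorem deck_smul_liftDiv (hsep : f.Separable) (ζ : CyclicCoverDeck L p) (α₀ : f.rootSet L)
    (x : f.rootSet L →₀ ZMod p) : ζ • liftDiv K p f α₀ x = liftDiv K p f α₀ x := by
  rw [liftDiv, Finset.smul_sum]
  exact Finset.sum_congr rfl fun α _ => by
    rw [← DistribMulAction.toAddMonoidHom_apply, map_zsmul, DistribMulAction.toAddMonoidHom_apply,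
      deck_smul_genDiv hsep]

omit [IsAlgClosed L] in
/-- Coefficient of `liftDiv x` at `T_α`: `ã_α - [α = α₀] ∑_β ã_β`. [folklore] -/
theorem liftDiv_apply_rootPlace (α₀ : f.rootSet L) (x : f.rootSet L →₀ ZMod p) (α : f.rootSet L) :
    liftDiv K p f α₀ x (rootPlace K L p f (α : L)) =
      ((x α).val : ℤ) - if α = α₀ then ∑ β : f.rootSet L, ((x β).val : ℤ) else 0 := by
  have hinj : ∀ β γ : f.rootSet L, rootPlace K L p f (β : L) = rootPlace K L p f (γ : L) ↔ β = γ :=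
    fun β γ => ⟨fun h => Subtype.ext (rootPlace_injective h), fun h => h ▸ rfl⟩
  rw [liftDiv, Finsupp.finsetSum_apply]
  simp only [genDiv, Finsupp.smul_apply, Finsupp.sub_apply, Finsupp.single_apply, hinj, smul_eq_mul, mul_sub,
    mul_ite, mul_one, mul_zero, Finset.sum_sub_distrib, Finset.sum_ite_eq', Finset.mem_univ, if_true]
  by_cases h : α = α₀
  · subst h; simp
  · rw [if_neg h]
    simp [Ne.symm h]

/-- The `𝔽_p`-linear map `𝔽_p^Ω → Pic[p]`, `e_α ↦ [T_α - T_{α₀}]`. [cite: Schaefer1998, §3] -/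
def liftLin {ζ₀ : L} (hζ₀ : IsPrimitiveRoot ζ₀ p) (hsep : f.Separable) (hdvd : p ∣ f.natDegree)
    (α₀ : f.rootSet L) : (f.rootSet L →₀ ZMod p) →ₗ[ZMod p] jacobianTorsion K L p f p :=
  Finsupp.linearCombination (ZMod p) (gen hζ₀ hsep hdvd α₀)

/-- **`liftLin x = [liftDiv x]`**. [folklore] -/
theorem coe_liftLin {ζ₀ : L} (hζ₀ : IsPrimitiveRoot ζ₀ p) (hsep : f.Separable) (hdvd : p ∣ f.natDegree)
    (α₀ : f.rootSet L) (x : f.rootSet L →₀ ZMod p) :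
    ((liftLin hζ₀ hsep hdvd α₀ x : jacobianTorsion K L p f p) : SuperellipticPic K L p f) =
      picMk K L p f (liftDiv K p f α₀ x) := by
  rw [liftLin, Finsupp.linearCombination_apply,
    Finsupp.sum_fintype x (fun i a => a • gen hζ₀ hsep hdvd α₀ i) (fun i => zero_smul _ _),
    AddSubmonoidClass.coe_finsetSum, liftDiv, map_sum]
  refine Finset.sum_congr rfl fun α _ => ?_
  rw [coe_zmod_smul, coe_gen, map_zsmul, natCast_zsmul]

/-- `liftLin 1_Ω = 0` (`∑_α (T_α - T_{α₀}) ∼ 0`). [cite: Schaefer1998, Prop. 3.2] -/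
theorem liftLin_constFinsupp {ζ₀ : L} (hζ₀ : IsPrimitiveRoot ζ₀ p) (hsep : f.Separable) (hdvd : p ∣ f.natDegree)
    (α₀ : f.rootSet L) : liftLin hζ₀ hsep hdvd α₀ (constFinsupp p (f.rootSet L)) = 0 := by
  haveI : Fact (1 < p) := ⟨hp.out.one_lt⟩
  obtain ⟨k, hk⟩ := hdvd
  apply Subtype.ext
  rw [coe_liftLin, ZeroMemClass.coe_zero, picMk_eq_zero_iff, liftDiv]
  simp only [constFinsupp_apply, ZMod.val_one, Nat.cast_one, one_smul]
  exact sum_single_sub_single_mem hζ₀ hsep hk (isRoot_of_mem_rootSet α₀.2)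

/-- `liftLin` kills `(𝔽_p^Ω)⁰ ∩ 𝔽_p · 1_Ω`. [folklore] -/
theorem augmentationConst_le_ker {ζ₀ : L} (hζ₀ : IsPrimitiveRoot ζ₀ p) (hsep : f.Separable)
    (hdvd : p ∣ f.natDegree) (α₀ : f.rootSet L) :
    augmentationConst p (f.rootSet L) ≤
      LinearMap.ker ((liftLin hζ₀ hsep hdvd α₀).comp (augmentationSubmodule (ZMod p) (f.rootSet L)).subtype) := by
  intro x hx
  obtain ⟨a, ha⟩ := (mem_augmentationConst p (f.rootSet L)).1 hx
  rw [LinearMap.mem_ker, LinearMap.comp_apply, Submodule.subtype_apply, ← ha, map_smul,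
    liftLin_constFinsupp, smul_zero]

/-- The `𝔽_p`-linear map `Heart → Pic[p]`. [cite: Schaefer1998, §3] -/
def psiLin {ζ₀ : L} (hζ₀ : IsPrimitiveRoot ζ₀ p) (hsep : f.Separable) (hdvd : p ∣ f.natDegree)
    (α₀ : f.rootSet L) : Heart p (f.rootSet L) →ₗ[ZMod p] jacobianTorsion K L p f p :=
  (augmentationConst p (f.rootSet L)).liftQ
    ((liftLin hζ₀ hsep hdvd α₀).comp (augmentationSubmodule (ZMod p) (f.rootSet L)).subtype)
    (augmentationConst_le_ker hζ₀ hsep hdvd α₀)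

/-- **The map `Ψ : Heart → Pic`** of the theorem (`a ↦ [∑_α ã_α (T_α - T_{α₀})]`, Zarhin's
`Ψ : φ ↦ cl(∑ a_P (P))`). [cite: Zarhin2018SuperellipticJacobians, Thm. 9.1 (proof)] -/
def psi {ζ₀ : L} (hζ₀ : IsPrimitiveRoot ζ₀ p) (hsep : f.Separable) (hdvd : p ∣ f.natDegree)
    (α₀ : f.rootSet L) : Heart p (f.rootSet L) →+ SuperellipticPic K L p f :=
  ((jacobianTorsion K L p f p).subtype).comp (psiLin hζ₀ hsep hdvd α₀).toAddMonoidHom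

/-- **`Ψ [a] = [liftDiv a]`** for `a ∈ (𝔽_p^Ω)⁰`. [folklore] -/
theorem psi_mk {ζ₀ : L} (hζ₀ : IsPrimitiveRoot ζ₀ p) (hsep : f.Separable) (hdvd : p ∣ f.natDegree)
    (α₀ : f.rootSet L) (x : augmentationSubmodule (ZMod p) (f.rootSet L)) :
    psi hζ₀ hsep hdvd α₀ (Submodule.Quotient.mk x) = picMk K L p f (liftDiv K p f α₀ x) := by
  show ((psiLin hζ₀ hsep hdvd α₀ (Submodule.Quotient.mk x) : jacobianTorsion K L p f p) :
    SuperellipticPic K L p f) = _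
  rw [psiLin, Submodule.liftQ_apply, LinearMap.comp_apply, Submodule.subtype_apply, coe_liftLin]

/-! ### `Ψ` lands in `J[1 - ζ]` -/

/-- **`Ψ v ∈ J[λ]`**: degree `0` and fixed by the deck group. [cite: Zarhin2018SuperellipticJacobians, Thm. 9.1] -/
theorem psi_mem_lambdaTorsion {ζ₀ : L} (hζ₀ : IsPrimitiveRoot ζ₀ p) (hsep : f.Separable) (hdvd : p ∣ f.natDegree)
    (α₀ : f.rootSet L) (v : Heart p (f.rootSet L)) : psi hζ₀ hsep hdvd α₀ v ∈ lambdaTorsion K L p f := by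
  induction v using Submodule.Quotient.induction_on with
  | H x =>
    rw [psi_mk, mem_lambdaTorsion]
    exact ⟨by rw [degree_picMk, degree_liftDiv hsep], fun ζ => by rw [deck_smul_picMk, deck_smul_liftDiv hsep]⟩

/-! ### `Gal`-equivariance -/

/-- **`Ψ` is `Gal`-equivariant**: `Ψ(σ · v) = σ · Ψ(v)`, because `σ T_α = T_{σ α}` and
`∑_α a_α = 0`. [cite: Zarhin2018SuperellipticJacobians, Thm. 9.1] -/
theorem psi_heartRep {ζ₀ : L} (hζ₀ : IsPrimitiveRoot ζ₀ p) (hsep : f.Separable) (hdvd : p ∣ f.natDegree)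
    (α₀ : f.rootSet L) {G : Type w} [Group G] [MulSemiringAction G L] [SMulCommClass G K L]
    [MulAction G (f.rootSet L)] (hG : ∀ (σ : G) (α : f.rootSet L), ((σ • α : f.rootSet L) : L) = σ • (α : L))
    (σ : G) (v : Heart p (f.rootSet L)) :
    psi hζ₀ hsep hdvd α₀ (heartRep p (f.rootSet L) G σ v) = σ • psi hζ₀ hsep hdvd α₀ v := by
  induction v using Submodule.Quotient.induction_on with
  | H x =>
    rw [heartRep_mk, psi_mk, psi_mk, smul_picMk]
    -- `σ • genDiv α₀ γ = genDiv α₀ (σ γ) - genDiv α₀ (σ α₀)`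
    have hT : ∀ γ : f.rootSet L, σ • rootPlace K L p f (γ : L) = rootPlace K L p f ((σ • γ : f.rootSet L) : L) :=
      fun γ => by rw [smul_rootPlace hsep σ (isRoot_of_mem_rootSet γ.2), hG]
    have hgen : ∀ γ : f.rootSet L, σ • genDiv K p f α₀ γ = genDiv K p f α₀ (σ • γ) - genDiv K p f α₀ (σ • α₀) := by
      intro γ
      rw [genDiv, smul_sub, Finsupp.comapSMul_single, Finsupp.comapSMul_single, hT, hT]
      simp only [genDiv]; abel
    -- the right-hand side
    have hR : σ • liftDiv K p f α₀ x =
        (∑ γ : f.rootSet L, (((x : f.rootSet L →₀ ZMod p) γ).val : ℤ) • genDiv K p f α₀ (σ • γ)) -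
          (∑ γ : f.rootSet L, (((x : f.rootSet L →₀ ZMod p) γ).val : ℤ)) • genDiv K p f α₀ (σ • α₀) := by
      rw [liftDiv, Finset.smul_sum, Finset.sum_smul, ← Finset.sum_sub_distrib]
      refine Finset.sum_congr rfl fun γ _ => ?_
      rw [← DistribMulAction.toAddMonoidHom_apply, map_zsmul, DistribMulAction.toAddMonoidHom_apply, hgen, smul_sub]
    -- the left-hand side, reindexed by `γ ↦ σ γ`
    have hL : liftDiv K p f α₀ (augmentationRep (ZMod p) G (f.rootSet L) σ x) =
        ∑ γ : f.rootSet L, (((x : f.rootSet L →₀ ZMod p) γ).val : ℤ) • genDiv K p f α₀ (σ • γ) := by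
      rw [liftDiv, coe_augmentationRep_apply]
      refine Fintype.sum_equiv (MulAction.toPerm σ⁻¹) _ _ fun β => ?_
      rw [MulAction.toPerm_apply, permRep_apply, smul_inv_smul]
    rw [hL, hR, map_sub]
    obtain ⟨m, hm⟩ := dvd_sum_val x
    have h0 : picMk K L p f ((∑ γ : f.rootSet L, (((x : f.rootSet L →₀ ZMod p) γ).val : ℤ)) •
        genDiv K p f α₀ (σ • α₀)) = 0 := by
      rw [hm, map_zsmul, mul_comm, mul_smul, natCast_zsmul, nsmul_picMk_genDiv hζ₀ hsep hdvd, smul_zero]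
    rw [h0, sub_zero]

/-! ### Injectivity: eigenvectors of the deck group are monomials in `y` -/

omit [IsAlgClosed L] hp in
/-- The deck action is `L(x)`-linear. [folklore] -/
theorem deck_smul_smul (ζ : CyclicCoverDeck L p) (r : RatFunc L) (z : SuperellipticFunctionField K L p f) :
    ζ • (r • z) = r • ζ • z :=
  (deckAlgHom K L p f ζ).toLinearMap.map_smul r z

omit [IsAlgClosed L] hp in
/-- `ζ • y^j = ζ^j y^j`, with `ζ^j` as a scalar of `L(x)`. [folklore] -/
theorem deck_smul_genY_pow (ζ : CyclicCoverDeck L p) (j : ℕ) :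
    ζ • genY K L p f ^ j = (algebraMap L (RatFunc L) ζ.val ^ j) • genY K L p f ^ j := by
  rw [smul_pow', deck_smul_genY, mul_pow, ← map_pow, Algebra.smul_def,
    IsScalarTower.algebraMap_apply L (RatFunc L) (SuperellipticFunctionField K L p f), map_pow]

omit [IsAlgClosed L] in
/-- **An eigenvector of the deck transformation `y ↦ ζ₀ y` is a monomial `r(x) y^j`** (expand in the
basis `1, y, …, y^{p-1}` of `L(C_f)/L(x)` and compare the eigenvalues `ζ₀^i`, pairwise distinct).
[cite: Schaefer1998, Prop. 3.2 (proof)] -/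
theorem exists_eq_smul_genY_pow {ζ₀ : L} (hζ₀ : IsPrimitiveRoot ζ₀ p) {h : SuperellipticFunctionField K L p f}
    (hh : h ≠ 0) {c : L} (hc : CyclicCoverDeck.ofRoot hζ₀.pow_eq_one • h = algebraMap L _ c * h) :
    ∃ (j : ℕ) (r : RatFunc L), j < p ∧ h = r • genY K L p f ^ j := by
  set δ := CyclicCoverDeck.ofRoot hζ₀.pow_eq_one with hδ
  set pb := AdjoinRoot.powerBasis (Fact.out : Irreducible (superellipticPoly K L p f)).ne_zero with hpb
  have hdim : pb.dim = p := by rw [hpb, AdjoinRoot.powerBasis_dim, natDegree_superellipticPoly]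
  set B := pb.basis with hBdef
  have hB : ∀ i, B i = genY K L p f ^ (i : ℕ) := fun i => by rw [hBdef, PowerBasis.coe_basis]; rfl
  set ξ : RatFunc L := algebraMap L (RatFunc L) ζ₀ with hξ
  have hξ' : IsPrimitiveRoot ξ p := hζ₀.map_of_injective (algebraMap L (RatFunc L)).injective
  set c' : RatFunc L := algebraMap L (RatFunc L) c with hc'
  -- coordinates of a combination of basis vectors
  have hcoord : ∀ (g : Fin pb.dim → RatFunc L) (i : Fin pb.dim), B.repr (∑ j, g j • B j) i = g i := by
    intro g i
    rw [map_sum, Finsupp.coe_finsetSum, Finset.sum_apply]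
    simp only [map_smul, Module.Basis.repr_self, Finsupp.smul_single, smul_eq_mul, mul_one, Finsupp.single_apply]
    rw [Finset.sum_ite_eq']
    simp
  -- `δ h` in coordinates, in two ways
  have h1 : δ • h = ∑ i, (B.repr h i * ξ ^ (i : ℕ)) • B i := by
    conv_lhs => rw [← B.sum_repr h]
    rw [Finset.smul_sum]
    refine Finset.sum_congr rfl fun i _ => ?_
    rw [deck_smul_smul, hB, deck_smul_genY_pow, CyclicCoverDeck.val_ofRoot, smul_smul]
  have h2 : δ • h = ∑ i, (c' * B.repr h i) • B i := by
    have : algebraMap L (SuperellipticFunctionField K L p f) c * h = c' • h := by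
      rw [Algebra.smul_def, hc', ← IsScalarTower.algebraMap_apply]
    rw [hc, this]
    conv_lhs => rw [← B.sum_repr h]
    rw [Finset.smul_sum]
    exact Finset.sum_congr rfl fun i _ => by rw [smul_smul]
  have hrepr : ∀ i, B.repr h i * ξ ^ (i : ℕ) = c' * B.repr h i := by
    intro i
    have := congrArg (fun z => B.repr z i) (h1.symm.trans h2)
    simp only [hcoord] at this
    exact this
  -- some coordinate is nonzero
  obtain ⟨j, hj⟩ : ∃ j, B.repr h j ≠ 0 := by
    by_contra hall
    push Not at hall
    apply hh
    rw [← B.sum_repr h]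
    exact Finset.sum_eq_zero fun i _ => by rw [hall i, zero_smul]
  have hcj : c' = ξ ^ (j : ℕ) := by
    have h := hrepr j
    rw [mul_comm] at h
    exact (mul_right_cancel₀ hj h).symm
  have hzero : ∀ i, i ≠ j → B.repr h i = 0 := by
    intro i hij
    by_contra hne
    have h := hrepr i
    rw [hcj, mul_comm (ξ ^ (j : ℕ))] at h
    have h' := mul_left_cancel₀ hne h
    exact hij (Fin.ext (hξ'.pow_inj (i.2.trans_eq hdim) (j.2.trans_eq hdim) h'))
  refine ⟨j, B.repr h j, j.2.trans_eq hdim, ?_⟩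
  conv_lhs => rw [← B.sum_repr h]
  rw [Finset.sum_eq_single j (fun i _ hij => by rw [hzero i hij, zero_smul])
    (fun h' => absurd (Finset.mem_univ j) h'), hB]

/-- **`Ψ` is injective** (Schaefer Prop. 3.2; Poonen–Schaefer Prop. 6.1): if `∑ ã_α (T_α - T_{α₀}) = (h)`
then `ζ₀ h / h` has divisor `0`, so `ζ₀ h = c h` and `h = r(x) y^j`; then
`ã_α - [α = α₀] ∑ ã = v_{T_α}(h) = p v_α(r) + j`, i.e. `a = j · 1_Ω` in `𝔽_p^Ω`.
[cite: Schaefer1998, Prop. 3.2] -/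
theorem psi_injective {ζ₀ : L} (hζ₀ : IsPrimitiveRoot ζ₀ p) (hsep : f.Separable) (hdvd : p ∣ f.natDegree)
    (α₀ : f.rootSet L) : Function.Injective (psi hζ₀ hsep hdvd α₀) := by
  haveI : NeZero p := ⟨hp.out.ne_zero⟩
  haveI := isIntegrallyClosedIn_of_isAlgClosed (K := L) (F := SuperellipticFunctionField K L p f)
  rw [injective_iff_map_eq_zero]
  intro v hv
  induction v using Submodule.Quotient.induction_on with
  | H x =>
    rw [psi_mk, picMk_eq_zero_iff, mem_principalDivisors_iff] at hv
    rw [Submodule.Quotient.mk_eq_zero, mem_augmentationConst]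
    obtain ⟨h, hh0, hdivh⟩ := hv
    set δ := CyclicCoverDeck.ofRoot hζ₀.pow_eq_one with hδ
    have hδh0 : δ • h ≠ 0 := (smul_ne_zero_iff_ne δ).2 hh0
    -- `ζ₀ h = c h`
    have hquot : principalDivisor L (δ • h * h⁻¹) = 0 := by
      rw [principalDivisor_mul hδh0 (inv_ne_zero hh0), principalDivisor_inv hh0, ← smul_principalDivisor, hdivh,
        deck_smul_liftDiv hsep, add_neg_cancel]
    obtain ⟨c, -, hc⟩ := exists_eq_algebraMap_of_principalDivisor_eq_zero (mul_ne_zero hδh0 (inv_ne_zero hh0)) hquot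
    have hδh : δ • h = algebraMap L _ c * h := by rw [hc, inv_mul_cancel_right₀ hh0]
    obtain ⟨j, r, hj, hhr⟩ := exists_eq_smul_genY_pow hζ₀ hh0 hδh
    have hr0 : r ≠ 0 := by rintro rfl; rw [zero_smul] at hhr; exact hh0 hhr
    have hy0 : genY K L p f ≠ 0 := genY_ne_zero hp.out.ne_zero hsep.ne_zero
    -- `v_{T_α}(h) = p v_α(r) + j`
    have hord : ∀ α : f.rootSet L, (rootPlace K L p f (α : L)).ord h = p * (placeXSubC (α : L)).ord r + j := by
      intro α
      have hα := isRoot_of_mem_rootSet (K := K) α.2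
      rw [hhr, Algebra.smul_def, (rootPlace K L p f (α : L)).ord_mul_eq ((_root_.map_ne_zero _).2 hr0) (pow_ne_zero _ hy0),
        (rootPlace K L p f (α : L)).ord_pow hy0, ord_rootPlace_genY hsep hα, ord_algebraMap_ratFunc,
        ramificationIdx_rootPlace hsep hα, restrict_rootPlace, mul_one]
    -- compare with the coefficients of `liftDiv x`
    set S : ℤ := ∑ β : f.rootSet L, (((x : f.rootSet L →₀ ZMod p) β).val : ℤ) with hS
    have hcoef : ∀ α : f.rootSet L, ((x : f.rootSet L →₀ ZMod p) α : ZMod p) =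
        (j : ZMod p) + if α = α₀ then (S : ZMod p) else 0 := by
      intro α
      have h1 : principalDivisor L h (rootPlace K L p f (α : L)) = liftDiv K p f α₀ x (rootPlace K L p f (α : L)) := by
        rw [hdivh]
      rw [principalDivisor_apply_of_ne_zero hh0, hord α, liftDiv_apply_rootPlace, ← hS] at h1
      -- `h1 : ↑p * v + ↑j = ↑(x α).val - (if α = α₀ then S else 0)` in `ℤ`
      have h2 : ((((x : f.rootSet L →₀ ZMod p) α).val : ℤ) : ZMod p) =
          (((p : ℤ) * (placeXSubC (α : L)).ord r + j + if α = α₀ then S else 0 : ℤ) : ZMod p) := by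
        rw [h1]; push_cast; ring
      rw [Int.cast_natCast, ZMod.natCast_zmod_val] at h2
      rw [h2]
      push_cast
      rw [ZMod.natCast_self, zero_mul, zero_add]
    obtain ⟨m, hm⟩ := dvd_sum_val x
    refine ⟨(j : ZMod p), ?_⟩
    ext α
    rw [Finsupp.smul_apply, constFinsupp_apply, smul_eq_mul, mul_one, hcoef α]
    split_ifs
    · rw [hS, hm]; push_cast; rw [ZMod.natCast_self, zero_mul, add_zero]
    · rw [add_zero]

/-! ### Hilbert's Theorem 90 for the cyclic group `⟨ζ₀⟩` acting on `L(C_f)` -/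

omit [IsAlgClosed L] in
/-- **Hilbert's Theorem 90** for the cyclic group of deck transformations `⟨y ↦ ζ₀ y⟩ ≅ ℤ/p` of
`L(C_f)`: an element `h` of norm `∏_{i<p} ζ₀^i(h) = 1` is of the form `g / ζ₀(g)`.  Classical proof by
Dedekind's independence of the characters `ζ₀^i : L(C_f)^× → L(C_f)` (Mathlib
`linearIndependent_monoidHom`): with `a_i = ∏_{j<i} ζ₀^j(h)` pick `θ` with
`g = ∑ a_i ζ₀^i(θ) ≠ 0`; then `h ζ₀(g) = g` since `h ζ₀(a_i) = a_{i+1}` and `a_p = N(h) = 1 = a_0`.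
[folklore] -/
theorem hilbert90 {ζ₀ : L} (hζ₀ : IsPrimitiveRoot ζ₀ p) (hf : f ≠ 0) {h : SuperellipticFunctionField K L p f}
    (hN : ∏ i ∈ Finset.range p, (CyclicCoverDeck.ofRoot hζ₀.pow_eq_one ^ i) • h = 1) :
    ∃ g : SuperellipticFunctionField K L p f, g ≠ 0 ∧ h * CyclicCoverDeck.ofRoot hζ₀.pow_eq_one • g = g := by
  haveI : NeZero p := ⟨hp.out.ne_zero⟩
  set δ := CyclicCoverDeck.ofRoot hζ₀.pow_eq_one with hδ
  have hδp : δ ^ p = 1 := CyclicCoverDeck.ofRoot_pow_eq_one hζ₀.pow_eq_one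
  -- partial norms `a i = ∏_{j<i} δ^j h`
  set a : ℕ → SuperellipticFunctionField K L p f := fun i => ∏ j ∈ Finset.range i, (δ ^ j) • h with ha
  have ha0 : a 0 = 1 := by simp [ha]
  have hap : a p = 1 := hN
  have hstep : ∀ i, h * δ • a i = a (i + 1) := by
    intro i
    simp only [ha]
    rw [Finset.prod_range_succ', pow_zero, one_smul, mul_comm, Finset.smul_prod']
    congr 1
    refine Finset.prod_congr rfl fun j _ => ?_
    rw [← mul_smul, ← pow_succ']
  -- the characters `δ^i` on units
  let θ : ℕ → (SuperellipticFunctionField K L p f →+* SuperellipticFunctionField K L p f) := fun i =>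
    MulSemiringAction.toRingHom (CyclicCoverDeck L p) _ (δ ^ i)
  let χ : Fin p → ((SuperellipticFunctionField K L p f)ˣ →* SuperellipticFunctionField K L p f) := fun i =>
    (θ i : SuperellipticFunctionField K L p f →* SuperellipticFunctionField K L p f).comp (Units.coeHom _)
  have hχ_apply : ∀ i (u : (SuperellipticFunctionField K L p f)ˣ),
      χ i u = (δ ^ (i : ℕ)) • (u : SuperellipticFunctionField K L p f) := fun i u => rfl
  have hχ : Function.Injective χ := by
    intro i j hij
    have hy0 := genY_ne_zero (K := K) (L := L) hp.out.ne_zero hf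
    have h1 := DFunLike.congr_fun hij (Units.mk0 _ hy0)
    rw [hχ_apply, hχ_apply, Units.val_mk0, deck_smul_genY, deck_smul_genY, CyclicCoverDeck.val_pow_eq_pow_val,
      CyclicCoverDeck.val_pow_eq_pow_val, CyclicCoverDeck.val_ofRoot] at h1
    exact Fin.ext (hζ₀.pow_inj i.2 j.2 ((algebraMap L _).injective (mul_right_cancel₀ hy0 h1)))
  have hli := (linearIndependent_monoidHom (SuperellipticFunctionField K L p f)ˣ
    (SuperellipticFunctionField K L p f)).comp χ hχ
  -- the combination `∑ a_i χ_i` is a nonzero function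
  have hne : (∑ i : Fin p, a i • (χ i : (SuperellipticFunctionField K L p f)ˣ → SuperellipticFunctionField K L p f)) ≠ 0 := by
    intro h0
    have h1 := Fintype.linearIndependent_iff.1 hli (fun i => a i) h0 ⟨0, hp.out.pos⟩
    change a 0 = 0 at h1
    rw [ha0] at h1
    exact one_ne_zero h1
  obtain ⟨u, hu⟩ := Function.ne_iff.1 hne
  set g : SuperellipticFunctionField K L p f :=
    ∑ i ∈ Finset.range p, a i * (δ ^ i) • (u : SuperellipticFunctionField K L p f) with hg
  have hgu : (∑ i : Fin p, a i • (χ i : (SuperellipticFunctionField K L p f)ˣ → SuperellipticFunctionField K L p f)) u = g := by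
    rw [Finset.sum_apply, hg, Finset.sum_range]
    simp only [Pi.smul_apply, smul_eq_mul, hχ_apply]
  refine ⟨g, by rw [← hgu]; simpa using hu, ?_⟩
  -- `h δ(g) = g`
  have hterm : ∀ i, h * δ • (a i * (δ ^ i) • (u : SuperellipticFunctionField K L p f)) =
      a (i + 1) * (δ ^ (i + 1)) • (u : SuperellipticFunctionField K L p f) := by
    intro i
    rw [smul_mul', ← mul_assoc, hstep, ← mul_smul, ← pow_succ']
  have key : ∑ i ∈ Finset.range p, a (i + 1) * (δ ^ (i + 1)) • (u : SuperellipticFunctionField K L p f) =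
      ∑ i ∈ Finset.range p, a i * (δ ^ i) • (u : SuperellipticFunctionField K L p f) := by
    have h1 := Finset.sum_range_succ' (fun k => a k * (δ ^ k) • (u : SuperellipticFunctionField K L p f)) p
    have h2 := Finset.sum_range_succ (fun k => a k * (δ ^ k) • (u : SuperellipticFunctionField K L p f)) p
    rw [hap, hδp] at h2
    rw [pow_zero, ha0] at h1
    linear_combination h2 - h1
  rw [hg, Finset.smul_sum, Finset.mul_sum]
  rw [Finset.sum_congr rfl fun i _ => hterm i]
  exact key

/-! ### Surjectivity onto `J[1 - ζ]` -/

omit [IsAlgClosed L] hp in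
/-- The principal divisor of a product. [folklore] -/
theorem principalDivisor_prod {ι : Type*} (s : Finset ι) (z : ι → SuperellipticFunctionField K L p f)
    (hz : ∀ i ∈ s, z i ≠ 0) : principalDivisor L (∏ i ∈ s, z i) = ∑ i ∈ s, principalDivisor L (z i) := by
  induction s using Finset.induction_on with
  | empty => rw [Finset.prod_empty, Finset.sum_empty, principalDivisor_one]
  | insert a s has ih =>
    rw [Finset.prod_insert has, Finset.sum_insert has,
      principalDivisor_mul (hz a (Finset.mem_insert_self a s))
        (Finset.prod_ne_zero_iff.2 fun i hi => hz i (Finset.mem_insert_of_mem hi)),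
      ih fun i hi => hz i (Finset.mem_insert_of_mem hi)]

/-- **`Ψ` maps onto `J[λ]`** (Schaefer Prop. 3.4): a degree-zero class fixed by the deck group is
represented — by Hilbert 90 — by a deck-invariant divisor, which is `∼ ∑_α D(T_α)(T_α - T_{α₀})`.
[cite: Schaefer1998, Prop. 3.4] -/
theorem exists_psi_eq {ζ₀ : L} (hζ₀ : IsPrimitiveRoot ζ₀ p) (hsep : f.Separable) (hdvd : p ∣ f.natDegree)
    (α₀ : f.rootSet L) {c : SuperellipticPic K L p f} (hc : c ∈ lambdaTorsion K L p f) :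
    ∃ v, psi hζ₀ hsep hdvd α₀ v = c := by
  haveI : NeZero p := ⟨hp.out.ne_zero⟩
  haveI := isIntegrallyClosedIn_of_isAlgClosed (K := L) (F := SuperellipticFunctionField K L p f)
  have hf : f ≠ 0 := hsep.ne_zero
  obtain ⟨hdeg, hfix⟩ := (mem_lambdaTorsion K L p f).1 hc
  obtain ⟨D, rfl⟩ := picMk_surjective (K := K) (L := L) (p := p) (f := f) c
  set δ := CyclicCoverDeck.ofRoot hζ₀.pow_eq_one with hδ
  have hδp : δ ^ p = 1 := CyclicCoverDeck.ofRoot_pow_eq_one hζ₀.pow_eq_one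
  -- `δ D - D = (h₀)`
  have h1 : δ • D - D ∈ principalDivisors L (SuperellipticFunctionField K L p f) := by
    rw [← picMk_eq_zero_iff, map_sub, ← deck_smul_picMk, hfix δ, sub_self]
  obtain ⟨h₀, hh₀, hdiv⟩ := mem_principalDivisors_iff.1 h1
  -- the norm of `h₀` is a constant
  have hN0 : ∏ i ∈ Finset.range p, (δ ^ i) • h₀ ≠ 0 :=
    Finset.prod_ne_zero_iff.2 fun i _ => (smul_ne_zero_iff_ne _).2 hh₀
  have hNdiv : principalDivisor L (∏ i ∈ Finset.range p, (δ ^ i) • h₀) = 0 := by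
    rw [principalDivisor_prod _ _ fun i _ => (smul_ne_zero_iff_ne _).2 hh₀]
    have : ∀ i, principalDivisor L ((δ ^ i) • h₀) = (fun k => (δ ^ k) • D) (i + 1) - (fun k => (δ ^ k) • D) i := by
      intro i
      simp only
      rw [← smul_principalDivisor, hdiv, smul_sub, ← mul_smul, ← pow_succ]
    rw [Finset.sum_congr rfl fun i _ => this i]
    refine (Finset.sum_range_sub (fun k => (δ ^ k) • D) p).trans ?_
    rw [hδp, one_smul, pow_zero, one_smul, sub_self]
  obtain ⟨c₀, hc₀0, hc₀⟩ := exists_eq_algebraMap_of_principalDivisor_eq_zero hN0 hNdiv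
  obtain ⟨d, hd⟩ := IsAlgClosed.exists_pow_nat_eq c₀ hp.out.pos
  have hd0 : d ≠ 0 := by rintro rfl; rw [zero_pow hp.out.ne_zero] at hd; exact hc₀0 hd.symm
  -- rescale: `h = h₀ / d` has norm `1` and the same divisor
  set h := h₀ * algebraMap L (SuperellipticFunctionField K L p f) d⁻¹ with hh
  have hι0 : algebraMap L (SuperellipticFunctionField K L p f) d⁻¹ ≠ 0 := (_root_.map_ne_zero _).2 (inv_ne_zero hd0)
  have hh0 : h ≠ 0 := mul_ne_zero hh₀ hι0
  have hNh : ∏ i ∈ Finset.range p, (δ ^ i) • h = 1 := by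
    have : ∀ i, (δ ^ i) • h = (δ ^ i) • h₀ * algebraMap L (SuperellipticFunctionField K L p f) d⁻¹ := fun i => by
      rw [hh, smul_mul', deck_smul_algebraMap]
    rw [Finset.prod_congr rfl fun i _ => this i, Finset.prod_mul_distrib, ← hc₀, Finset.prod_const, Finset.card_range,
      ← map_pow, ← map_mul, ← hd, inv_pow, mul_inv_cancel₀ (pow_ne_zero _ hd0), map_one]
  have hdivh : principalDivisor L h = δ • D - D := by
    rw [hh, principalDivisor_mul hh₀ hι0, map_inv₀, principalDivisor_inv ((_root_.map_ne_zero _).2 hd0),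
      principalDivisor_algebraMap hd0, neg_zero, add_zero, hdiv]
  -- Hilbert 90
  obtain ⟨g, hg0, hg⟩ := hilbert90 hζ₀ hf hNh
  set D' := D + principalDivisor L g with hD'def
  have hD'δ : δ • D' = D' := by
    have h2 := congrArg (principalDivisor L) hg
    rw [principalDivisor_mul hh0 ((smul_ne_zero_iff_ne δ).2 hg0), ← smul_principalDivisor, hdivh] at h2
    rw [hD'def, smul_add]
    calc δ • D + δ • principalDivisor L g = (δ • D - D + δ • principalDivisor L g) + D := by abel
      _ = principalDivisor L g + D := by rw [h2]
      _ = D + principalDivisor L g := add_comm _ _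
  have hD' : ∀ ζ : CyclicCoverDeck L p, ζ • D' = D' := forall_deck_smul_eq_of_smul_eq hζ₀ hD'δ
  have hDD' : picMk K L p f D' = picMk K L p f D := by
    rw [hD'def, map_add, (picMk_eq_zero_iff _).2 (principalDivisor_mem hg0), add_zero]
  have hdeg' : D'.degree = 0 := by
    rw [hD'def, map_add, degree_principalDivisor_eq_zero hg0, add_zero]
    exact hdeg
  -- the invariant divisor `D'` is `∼ ∑_α D'(T_α) (T_α - T_{α₀})`
  obtain ⟨hmem, hdvdS⟩ := sub_sum_smul_sub_degree_smul_mem_of_invariant hζ₀ hsep hdvd α₀ hD'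
  rw [hdeg', zero_smul, sub_zero] at hmem
  rw [hdeg', zero_sub, dvd_neg] at hdvdS
  -- the vector `a_α = D'(T_α) mod p` is in the augmentation submodule
  set x : f.rootSet L →₀ ZMod p :=
    Finsupp.equivFunOnFinite.symm (fun α => ((D' (rootPlace K L p f (α : L)) : ℤ) : ZMod p)) with hx
  have hx_apply : ∀ α, x α = ((D' (rootPlace K L p f (α : L)) : ℤ) : ZMod p) := fun α => by
    rw [hx, Finsupp.coe_equivFunOnFinite_symm]
  have hxmem : x ∈ augmentationSubmodule (ZMod p) (f.rootSet L) := by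
    rw [mem_augmentationSubmodule_iff, augmentation, Finsupp.linearCombination_apply,
      Finsupp.sum_fintype x (fun _ a => a • (1 : ZMod p)) (fun _ => zero_smul _ _)]
    simp only [smul_eq_mul, mul_one, hx_apply]
    rw [← Int.cast_sum, ZMod.intCast_zmod_eq_zero_iff_dvd]
    exact hdvdS
  refine ⟨Submodule.Quotient.mk ⟨x, hxmem⟩, ?_⟩
  rw [psi_mk, ← hDD']
  -- `[liftDiv x] = [∑ D'(T_α) genDiv] = [D']`
  have hxval : ∀ α : f.rootSet L, (((x α).val : ℕ) : ℤ) = D' (rootPlace K L p f (α : L)) % p := fun α => by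
    rw [hx_apply, ZMod.val_intCast]
  have hlift : picMk K L p f (liftDiv K p f α₀ x) =
      picMk K L p f (∑ α : f.rootSet L, D' (rootPlace K L p f (α : L)) • genDiv K p f α₀ α) := by
    rw [← sub_eq_zero, ← map_sub, liftDiv, ← Finset.sum_sub_distrib, picMk_eq_zero_iff]
    refine AddSubgroup.sum_mem _ fun α _ => ?_
    rw [← sub_smul, hxval α]
    have heq : D' (rootPlace K L p f (α : L)) % p - D' (rootPlace K L p f (α : L)) =
        (-(D' (rootPlace K L p f (α : L)) / p)) * p := by
      rw [Int.emod_def]; ring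
    rw [heq, mul_smul]
    exact AddSubgroup.zsmul_mem _ (smul_single_sub_single_mem hζ₀ hsep hdvd (isRoot_of_mem_rootSet α.2)
      (isRoot_of_mem_rootSet α₀.2)) _
  rw [hlift, eq_comm, ← sub_eq_zero, ← map_sub, picMk_eq_zero_iff]
  exact hmem

end Construction

end SuperellipticFunctionField

/-! ### The theorem -/

/-- **Discharge of `superelliptic_lambdaTorsion_iso_heart`** (Zarhin 2018 Thm. 9.1 for `q = p`;
Poonen–Schaefer 1997; Schaefer 1998 Prop. 3.2–3.4): for `K` a field, `p` prime, `K ∋ ζ_p`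
primitive, `f ∈ K[X]` separable of degree `≥ 3` divisible by `p`, the map
`Ψ : ((𝔽_p^{R_f})⁰ / 𝔽_p 1) → Pic(C_{f, K̄})`, `a ↦ [∑ ã_α ((α, 0) - (α₀, 0))]`, is injective,
`Gal(K̄/K)`-equivariant, with image `J[1 - ζ] =` the degree-zero deck-invariant classes.  (The
hypothesis `(p : K) ≠ 0` of the fact is implied by the existence of `ζ_p` and is not used.)
[cite: Zarhin2018SuperellipticJacobians, Thm. 9.1] -/
theorem superelliptic_lambdaTorsion_iso_heart_holds : superelliptic_lambdaTorsion_iso_heart := by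
  intro K _ p _ f _ hζ hsep hdeg3 hdvd _
  obtain ⟨ζK, hζK⟩ := hζ
  have hζ₀ : IsPrimitiveRoot (algebraMap K (AlgebraicClosure K) ζK) p :=
    hζK.map_of_injective (algebraMap K (AlgebraicClosure K)).injective
  have hcard : 0 < Fintype.card (f.rootSet (AlgebraicClosure K)) := by
    rw [SuperellipticFunctionField.card_rootSet (K := K) hsep]; omega
  obtain ⟨α₀⟩ := Fintype.card_pos_iff.1 hcard
  refine ⟨SuperellipticFunctionField.psi hζ₀ hsep hdvd α₀,
    SuperellipticFunctionField.psi_injective hζ₀ hsep hdvd α₀, ?_,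
    fun σ v => SuperellipticFunctionField.psi_heartRep hζ₀ hsep hdvd α₀ (fun _ _ => rfl) σ v⟩
  refine le_antisymm ?_ fun c hc => ?_
  · rintro _ ⟨v, rfl⟩
    exact SuperellipticFunctionField.psi_mem_lambdaTorsion hζ₀ hsep hdvd α₀ v
  · exact SuperellipticFunctionField.exists_psi_eq hζ₀ hsep hdvd α₀ hc

end Literature.NumberTheory.GaloisRepresentations
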